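import Literature.NumberTheory.LFunctions.PiLiOscillationFromZero
import Literature.NumberTheory.LFunctions.NicolasLiThetaCriterion
import Literature.NumberTheory.LFunctions.NicolasOmega
import Literature.NumberTheory.LFunctions.RobinOscillation
import Literature.NumberTheory.LFunctions.LogIntegralBridgeProofs
import Literature.NumberTheory.LFunctions.LogIntegralOffsetProofs
import Mathlib.Analysis.SpecialFunctions.Pow.Asymptotics
import HarnessLib

/-!
# RH-FREE — Robin 1984 (Toulouse), Lemmas 1–2: if RH fails, `A(x) = li(θ(x)) − π(x) = Ω±(x^b)` for some `b > 1/2` — the named fact `Robin1984Toulouse_lemma2` DISCHARGED; nothing here bears on the truth of RH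

RH-FREE (an implication `¬RH → …` and oscillation theorems "at a zero `ρ₀` of `ζ`"; nothing is
asserted about RH). Literature-typing tranche `rh-lit-broughan-1` (Broughan, *Equivalents of the
Riemann Hypothesis* vol. 3, Ch. 1 "Nicolas' `π(x) < li(θ(x))` equivalence"; Robin, Ann. Fac. Sci.
Toulouse (5) 6 (1984) 257–268, §4 "Lemmes préliminaires"; Nicolas 2017, proof of Cor. 1.1). The file
`NicolasLiThetaCriterion.lean` typed Robin's Lemma 2 (`k = 1`) as the NAMED FACT
`Robin1984Toulouse_lemma2` (`¬RH ⟹ ∃ b > 1/2, c > 0: A(x) ≥ c x^b` and `A(x) ≤ −c x^b` each for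
arbitrarily large `x`); here it is PROVED, following Robin's §4 (read from the Numdam scan
[corpus:paper:doi-10-5802-afst-611 p0009–p0012], `k = 1`, `l = 1`):

* **Lemma 1** (Robin p. 265: "Nous allons calculer la transformée de Mellin de `D(x;k,l) log x` et
  utiliser le théorème de Landau"). With `D(x) = (ψ(x) − x)/log x − (Π(x) − L(x))` (`Π = ∑ Λ(n)/log n`,
  `L = li(max(2,·)) − li 2`, the tree's `PiLi.piSubLi`), the transform of `D(x) log x` on `Re s > 1` is
  `(q(s) − 1)/s − Λ̃(s)/s²` (`RobinLiTheta.mellinIoi_dLog`: the poles of `ζ₁'/ζ₁` coming from `ψ` and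
  from `(Π − L) log x = −(d/ds)` of `Λ̃/s` CANCEL, leaving the logarithmic singularities of
  `Λ̃ = "log((s−1)ζ(s))"`). Landau's lemma (the tree's `Landau.integrableOn_of_differentiableOn_union_convex`,
  MV Lemma 15.1) run exactly as in the tree's `PiLiOscillationFromZero.lean` (primitive of `ζ₁'/ζ₁ + q`
  on the hole-free region, identity theorem, `ζ₁ = C e^{Λ_H − ∫q}` on the half-plane of convergence)
  gives `RobinLiTheta.frequently_le_dLog_and_dLog_le`: at every zero `ρ₀` and for every
  `0 < b < Re ρ₀`, `c > 0`, `D(x) log x ≥ c x^b` and `≤ −c x^b` each hold for arbitrarily large `x`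
  (a zero of `ζ₁` inside the half-plane of holomorphy of its logarithm is absurd; no endgame at the
  abscissa is needed because `b < Re ρ₀` strictly).
* **From `D` to `A`** (Robin (13): "`B = D + O(x^{2Θ−1})`"): exactly,
  `A = D + li 2 − (ψ − θ)/log x + (Π − π) − gap`, `gap = (θ − x)/log x − (li θ(x) − li x) ∈
  [0, (θ(x) − x)²/(u log² u)]` for `1 < u ≤ min(x, θ(x))` (concavity of `li`;
  `RobinLiTheta.liThetaSubPi_eq_robinD_add`, `gap_le`, `liThetaSubPi_le`, `le_liThetaSubPi`).
* **Lemma 2, `Ω₋`** (Robin: "l'inégalité `B ≤ D` donne `B = Ω₋`"): `RobinLiTheta.frequently_liThetaSubPi_le_neg`.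
* **Lemma 2, `Ω₊`** (Robin p. 266: "La démonstration de `B = Ω₊(x^ξ)` demande plus d'efforts"): with
  `y = D − x^ξ`, continuous with right derivative `(x − ψ(x) − ξx^ξ log²x)/(x log²x)`
  (`RobinLiTheta.continuousOn_robinD`, `hasDerivWithinAt_robinD`, `integral_dDeriv_eq`), `y` has an
  interior maximum `m` between a point where `y < 0`, a later one where `y > 0` and a still later one
  where `y < 0` (all from Lemma 1); there `|ψ(m) − m| ≤ ξ m^ξ log² m + log m`
  (`RobinLiTheta.n0_sub_psi_bounds_of_isMax`: else `y` would increase just right of `m` or decrease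
  just left of `m` — Robin's "`y'` s'annule au plus une fois … l'ensemble `A` est infini"), so the gap
  is `o(m^ξ)` and `A(m) ≥ m^ξ/2` (`RobinLiTheta.half_rpow_le_liThetaSubPi`,
  `frequently_le_liThetaSubPi`). Robin runs this only when `Θ = 1` and uses `ψ − x = O(x^{Θ+ε})`
  otherwise; run at a single zero with `ξ < b < Re ρ₀` it needs no case distinction (our deviation).
* **`Robin1984Toulouse_lemma2_holds`** (the discharge, with `b = (1/2 + Re ρ₀)/2`, `c = 1/2` at a zero
  `ρ₀` with `Re ρ₀ > 1/2` supplied by `¬RH` and `ξ(1−s) = ξ(s)`), and the now unconditional halves of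
  Robin's Thm. 1 / Nicolas's Cor. 1.1: `riemannHypothesis_of_eventually_liThetaSubPi_pos`
  ("`A(x) > 0` pour `x` assez grand" `⟹` RH) and the `_of` criteria of `NicolasLiThetaCriterion.lean`
  with only `Nicolas2017_thm1_1` left as hypothesis.

## References

* G. Robin, *Sur la différence `Li(θ(x)) − π(x)`*, Ann. Fac. Sci. Toulouse (5) 6 (1984) 257–268,
  §4 Lemme 1, Lemme 2, (13), (15)–(16). [Robin1984Toulouse] (held: [corpus:paper:doi-10-5802-afst-611])
* J.-L. Nicolas, *Estimates of `li(θ(x)) − π(x)` and the Riemann Hypothesis*, Springer PROMS 221 (2017),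
  proof of Cor. 1.1. [Nicolas2017]
* H. L. Montgomery, R. C. Vaughan, *Multiplicative Number Theory I*, §15.1 (Lemma 15.1, Thms. 15.2–15.3).
  [MontgomeryVaughan2007]
* K. Broughan, *Equivalents of the Riemann Hypothesis* vol. 3, CUP 2023, Ch. 1. [Broughan2023Further]
-/

noncomputable section

open Filter Topology Set MeasureTheory ArithmeticFunction
open scoped Chebyshev

namespace Literature.NumberTheory.LFunctions

namespace RobinLiTheta

open PiLi

section Landau

open Complex Landau Nicolas

/-! ### The function `D(x) log x = (ψ(x) − x) − (Π(x) − L(x)) log x` and its transform -/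

/-- Robin's `D(x) log x`, written with `ψ` and `Π`: `(ψ(x) − x) − (Π(x) − L(x)) log x`
(`Π − L = PiLi.piSubLi`). [cite: Robin1984Toulouse, §4 Lemme 1 ("transformée de Mellin de D(x;k,l) log x")] -/
def dLog (x : ℝ) : ℝ := (Chebyshev.psi x - x) - piSubLi x * Real.log x

/-- The comparison function `G(x) = c x^b − η D(x) log x` (`η = ±1`) of Landau's argument.
[cite: Robin1984Toulouse, §4 Lemme 1; MontgomeryVaughan2007, §15.1 (proof of Thm. 15.2)] -/
def cmp (c b η : ℝ) (x : ℝ) : ℝ := c * x ^ b - η * dLog x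

/-- Measurability of `D log`. [folklore] -/
private theorem measurable_dLog : Measurable dLog :=
  (Nicolas.measurable_psi.sub measurable_id).sub (measurable_piSubLi.mul Real.measurable_log)

/-- Measurability of `G`. [folklore] -/
private theorem measurable_cmp (c b η : ℝ) : Measurable (cmp c b η) :=
  (measurable_const.mul (measurable_id.pow_const _)).sub (measurable_const.mul measurable_dLog)

/-- `|D(x) log x| ≤ 8 x²` for `x > 1`. [folklore] -/
private theorem abs_dLog_le {x : ℝ} (hx : 1 < x) : |dLog x| ≤ 8 * x ^ 2 := by
  have hx0 : 0 < x := by linarith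
  have h1 : |Chebyshev.psi x - x| ≤ 6 * x := Nicolas.abs_psi_sub_self_le hx0.le
  have h2 : |piSubLi x| ≤ 2 * x := abs_piSubLi_le hx0.le
  have h3 : 0 ≤ Real.log x := Real.log_nonneg hx.le
  have h4 : Real.log x ≤ x := (Real.log_le_sub_one_of_pos hx0).trans (by linarith)
  have hx1 : x ≤ x ^ 2 := by nlinarith
  unfold dLog
  calc |Chebyshev.psi x - x - piSubLi x * Real.log x|
      ≤ |Chebyshev.psi x - x| + |piSubLi x * Real.log x| := abs_sub _ _
    _ = |Chebyshev.psi x - x| + |piSubLi x| * Real.log x := by rw [abs_mul, abs_of_nonneg h3]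
    _ ≤ 6 * x + 2 * x * x := by
        refine add_le_add h1 ?_
        exact mul_le_mul h2 h4 h3 (by positivity)
    _ ≤ 8 * x ^ 2 := by nlinarith

/-- `|G(x)| ≤ (c + 8) x²` on `(1, ∞)` (for `c ≥ 0`, `b ≤ 1`, `|η| = 1`). [folklore] -/
private theorem abs_cmp_le {c b η : ℝ} (hc : 0 ≤ c) (hb : b ≤ 1) (hη : η = 1 ∨ η = -1) {x : ℝ}
    (hx : 1 < x) : |cmp c b η x| ≤ (c + 8) * x ^ 2 := by
  have hx0 : 0 < x := by linarith
  have hηabs : |η| = 1 := by rcases hη with rfl | rfl <;> norm_num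
  have hxb : x ^ b ≤ x ^ 2 := by
    calc x ^ b ≤ x ^ (1 : ℝ) := Real.rpow_le_rpow_of_exponent_le hx.le hb
      _ = x := Real.rpow_one x
      _ ≤ x ^ 2 := by nlinarith
  unfold cmp
  calc |c * x ^ b - η * dLog x| ≤ |c * x ^ b| + |η * dLog x| := abs_sub _ _
    _ = c * x ^ b + |dLog x| := by
        rw [abs_mul, abs_mul, hηabs, one_mul, abs_of_nonneg hc, abs_of_nonneg (Real.rpow_nonneg hx0.le _)]
    _ ≤ c * x ^ 2 + 8 * x ^ 2 := add_le_add (mul_le_mul_of_nonneg_left hxb hc) (abs_dLog_le hx)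
    _ = (c + 8) * x ^ 2 := by ring

/-- A measurable `g` with `|g(x)| ≤ C x²` on `(1, ∞)` has `∫_1^∞ |g| x^{-(σ+1)} dx < ∞` for `σ > 2`. [folklore] -/
private theorem integrableOn_rpow_of_abs_le_mul_sq {g : ℝ → ℝ} (hg : Measurable g) {C : ℝ}
    (hC : ∀ x, 1 < x → |g x| ≤ C * x ^ 2) {σ : ℝ} (hσ : 2 < σ) :
    IntegrableOn (fun x ↦ g x * x ^ (-(σ + 1))) (Ioi 1) := by
  have h1 : IntegrableOn (fun x : ℝ ↦ C * x ^ (-(σ - 1))) (Ioi 1) :=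
    (integrableOn_Ioi_rpow_of_lt (by linarith) zero_lt_one).const_mul C
  refine Integrable.mono' h1 ((hg.mul (measurable_id.pow_const _))).aestronglyMeasurable ?_
  rw [ae_restrict_iff' measurableSet_Ioi]
  refine Eventually.of_forall fun x (hx : 1 < x) ↦ ?_
  have hx0 : 0 < x := zero_lt_one.trans hx
  rw [norm_mul, Real.norm_eq_abs, Real.norm_eq_abs, abs_of_pos (Real.rpow_pos_of_pos hx0 _)]
  have hpow : x ^ 2 * x ^ (-(σ + 1)) = x ^ (-(σ - 1)) := by
    rw [show (x ^ 2 : ℝ) = x ^ (2 : ℝ) by norm_cast, ← Real.rpow_add hx0]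
    congr 1; ring
  calc |g x| * x ^ (-(σ + 1)) ≤ C * x ^ 2 * x ^ (-(σ + 1)) :=
        mul_le_mul_of_nonneg_right (hC x hx) (Real.rpow_nonneg hx0.le _)
    _ = C * x ^ (-(σ - 1)) := by rw [mul_assoc, hpow]

/-- A measurable `g` with `|g(x)| ≤ C x^a` on `(1, ∞)` has `∫_1^∞ |g| x^{-(σ+1)} dx < ∞` for `σ > a`. [folklore] -/
private theorem integrableOn_rpow_of_abs_le_mul_rpow {g : ℝ → ℝ} (hg : Measurable g) {C a : ℝ}
    (hC : ∀ x, 1 < x → |g x| ≤ C * x ^ a) {σ : ℝ} (hσ : a < σ) :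
    IntegrableOn (fun x ↦ g x * x ^ (-(σ + 1))) (Ioi 1) := by
  have h1 : IntegrableOn (fun x : ℝ ↦ C * x ^ (a - (σ + 1))) (Ioi 1) :=
    (integrableOn_Ioi_rpow_of_lt (by linarith) zero_lt_one).const_mul C
  refine Integrable.mono' h1 ((hg.mul (measurable_id.pow_const _))).aestronglyMeasurable ?_
  rw [ae_restrict_iff' measurableSet_Ioi]
  refine Eventually.of_forall fun x (hx : 1 < x) ↦ ?_
  have hx0 : 0 < x := zero_lt_one.trans hx
  rw [norm_mul, Real.norm_eq_abs, Real.norm_eq_abs, abs_of_pos (Real.rpow_pos_of_pos hx0 _)]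
  have hpow : x ^ a * x ^ (-(σ + 1)) = x ^ (a - (σ + 1)) := by
    rw [show a - (σ + 1) = a + (-(σ + 1)) by ring, Real.rpow_add hx0]
  calc |g x| * x ^ (-(σ + 1)) ≤ C * x ^ a * x ^ (-(σ + 1)) :=
        mul_le_mul_of_nonneg_right (hC x hx) (Real.rpow_nonneg hx0.le _)
    _ = C * x ^ (a - (σ + 1)) := by rw [mul_assoc, hpow]

/-- Measurability of `P(x) log x`. [folklore] -/
private theorem measurable_piSubLi_mul_log : Measurable (fun x : ℝ ↦ piSubLi x * Real.log x) :=
  measurable_piSubLi.mul Real.measurable_log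

/-- `|P(x) log x| ≤ (2/ε) x^{1+ε}` for `x > 1`, `ε > 0`. [folklore] -/
private theorem abs_piSubLi_mul_log_le {ε : ℝ} (hε : 0 < ε) {x : ℝ} (hx : 1 < x) :
    |piSubLi x * Real.log x| ≤ 2 / ε * x ^ (1 + ε) := by
  have hx0 : 0 < x := by linarith
  have h3 : 0 ≤ Real.log x := Real.log_nonneg hx.le
  have h4 : Real.log x ≤ x ^ ε / ε := Real.log_le_rpow_div hx0.le hε
  rw [abs_mul, abs_of_nonneg h3]
  calc |piSubLi x| * Real.log x ≤ 2 * x * (x ^ ε / ε) :=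
        mul_le_mul (abs_piSubLi_le hx0.le) h4 h3 (by positivity)
    _ = 2 / ε * (x ^ (1 : ℝ) * x ^ ε) := by rw [Real.rpow_one]; ring
    _ = 2 / ε * x ^ (1 + ε) := by rw [← Real.rpow_add hx0]

/-- `|D(x) log x| ≤ (6 + 2/ε) x^{1+ε}` for `x > 1`, `ε > 0`. [folklore] -/
private theorem abs_dLog_le_rpow {ε : ℝ} (hε : 0 < ε) {x : ℝ} (hx : 1 < x) :
    |dLog x| ≤ (6 + 2 / ε) * x ^ (1 + ε) := by
  have hx0 : 0 < x := by linarith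
  have h1 : |Chebyshev.psi x - x| ≤ 6 * x := Nicolas.abs_psi_sub_self_le hx0.le
  have h2 := abs_piSubLi_mul_log_le hε hx
  have hx1 : x ≤ x ^ (1 + ε) := by
    calc x = x ^ (1 : ℝ) := (Real.rpow_one x).symm
      _ ≤ x ^ (1 + ε) := Real.rpow_le_rpow_of_exponent_le hx.le (by linarith)
  unfold dLog
  calc |Chebyshev.psi x - x - piSubLi x * Real.log x|
      ≤ |Chebyshev.psi x - x| + |piSubLi x * Real.log x| := abs_sub _ _
    _ ≤ 6 * x ^ (1 + ε) + 2 / ε * x ^ (1 + ε) := add_le_add (h1.trans (by nlinarith)) h2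
    _ = (6 + 2 / ε) * x ^ (1 + ε) := by ring

/-- Integrability of `P(x) x^{-(σ+1)}` on `(1,∞)` for `σ > 1` (`|P| ≤ 2x`). [folklore] -/
private theorem integrableOn_piSubLi_rpow {σ : ℝ} (hσ : 1 < σ) :
    IntegrableOn (fun x ↦ piSubLi x * x ^ (-(σ + 1))) (Ioi 1) :=
  integrableOn_rpow_of_abs_le_mul_self measurable_piSubLi (C := 2)
    (fun x hx ↦ abs_piSubLi_le (by linarith)) hσ

/-- The transform of `P(x) log x` is `−mellinIoiLog P 1` (the `s`-derivative kernel `−log x`).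
[cite: MontgomeryVaughan2007, §15.1 Lemma 15.1] -/
private theorem mellinIoi_piSubLi_mul_log (s : ℂ) :
    mellinIoi (fun x ↦ piSubLi x * Real.log x) s = -mellinIoiLog piSubLi 1 s := by
  unfold mellinIoi mellinIoiLog mellinIntegrand
  rw [← integral_neg]
  refine setIntegral_congr_fun measurableSet_Ioi fun x _ ↦ ?_
  push_cast
  ring

/-- **The transform of `P(x) log x`** on `Re s > 1`:
`∫_1^∞ P(x) log x · x^{-s-1} dx = (Λ̃(s) − s(ζ₁'/ζ₁(s) + q(s)))/s²` (`= −(Λ̃(s)/s)'`, by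
differentiation under the integral sign and `s ∫ P x^{-s-1} = Λ̃`). [cite: MontgomeryVaughan2007, §15.1 (proof of Thm. 15.2)] -/
theorem mellinIoi_piSubLi_mul_log_eq {s : ℂ} (hs : 1 < s.re) :
    mellinIoi (fun x ↦ piSubLi x * Real.log x) s =
      (lamTilde s - s * (logDeriv riemannZeta₁ s + qFn s)) / s ^ 2 := by
  have hs0 : s ≠ 0 := by rintro rfl; simp at hs; linarith
  -- `(mellinIoi P)' = mellinIoiLog P 1` at `s`
  have hD : HasDerivAt (mellinIoi piSubLi) (mellinIoiLog piSubLi 1 s) s := by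
    have h := hasDerivAt_mellinIoiLog measurable_piSubLi (σ₁ := (1 + s.re) / 2)
      (integrableOn_piSubLi_rpow (by linarith)) 0 (s₀ := s) (by linarith)
    rwa [mellinIoiLog_zero] at h
  -- `mellinIoi P = Λ̃/s` near `s`
  have hEq : (fun z ↦ lamTilde z / z) =ᶠ[𝓝 s] mellinIoi piSubLi := by
    filter_upwards [(isOpen_re_gt 1).mem_nhds hs] with z hz
    have hz' : 1 < z.re := hz
    have hz0 : z ≠ 0 := by rintro rfl; simp at hz'; linarith
    rw [← mul_mellinIoi_piSubLi hz']
    field_simp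
  have hD2 : HasDerivAt (fun z ↦ lamTilde z / z)
      (((logDeriv riemannZeta₁ s + qFn s) * s - lamTilde s * 1) / s ^ 2) s :=
    (hasDerivAt_lamTilde hs).div (hasDerivAt_id s) hs0
  have hD2' : HasDerivAt (mellinIoi piSubLi)
      (((logDeriv riemannZeta₁ s + qFn s) * s - lamTilde s * 1) / s ^ 2) s :=
    hD2.congr_of_eventuallyEq hEq.symm
  have huniq := hD.unique hD2'
  rw [mellinIoi_piSubLi_mul_log, huniq]
  field_simp
  ring

/-- **The transform of `D(x) log x`** on `Re s > 1` (Robin: "Pour Re(s) > 1, on a …"):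
`∫_1^∞ D(x) log x · x^{-s-1} dx = (q(s) − 1)/s − Λ̃(s)/s²` — the poles of `ζ₁'/ζ₁` from `ψ − x`
(`−(ζ₁'/ζ₁ + 1)/s`) and from `(Π − L) log x` CANCEL, leaving only the logarithmic singularities of `Λ̃`.
[cite: Robin1984Toulouse, §4 Lemme 1 (Mellin transform of D log x)] -/
theorem mellinIoi_dLog {s : ℂ} (hs : 1 < s.re) :
    mellinIoi dLog s = (qFn s - 1) / s - lamTilde s / s ^ 2 := by
  have hs0 : s ≠ 0 := by rintro rfl; simp at hs; linarith
  have hIψ : Integrable (fun x : ℝ ↦ ((Chebyshev.psi x - x : ℝ) : ℂ) * (x : ℂ) ^ (-(s + 1)))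
      (volume.restrict (Ioi 1)) :=
    integrable_ofReal_mul_cpow (Nicolas.measurable_psi.sub measurable_id) (σ₁ := (1 + s.re) / 2)
      (s := s) (PsiOmega.integrableOn_psi_sub_self_rpow (by linarith)) (by linarith)
  have hIP : Integrable (fun x : ℝ ↦ ((piSubLi x * Real.log x : ℝ) : ℂ) * (x : ℂ) ^ (-(s + 1)))
      (volume.restrict (Ioi 1)) := by
    have hε : 0 < (s.re - 1) / 4 := by linarith
    refine integrable_ofReal_mul_cpow measurable_piSubLi_mul_log
      (σ₁ := (1 + s.re) / 2) (s := s) ?_ (by linarith)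
    exact integrableOn_rpow_of_abs_le_mul_rpow measurable_piSubLi_mul_log
      (fun x hx ↦ abs_piSubLi_mul_log_le hε hx) (by linarith)
  unfold dLog
  rw [mellinIoi_sub' hIψ hIP, PsiOmega.mellinIoi_psi_sub_self hs, mellinIoi_piSubLi_mul_log_eq hs]
  field_simp
  ring

/-- **The transform of `G`** on `Re s > 1`: `c/(s−b) − η((q(s) − 1)/s − Λ̃(s)/s²)`.
[cite: Robin1984Toulouse, §4 Lemme 1] -/
theorem mellinIoi_cmp {c b η : ℝ} (hb : b ≤ 1) {s : ℂ} (hs : 1 < s.re) :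
    mellinIoi (cmp c b η) s = c / (s - b) - η * ((qFn s - 1) / s - lamTilde s / s ^ 2) := by
  have hIk : Integrable (fun x : ℝ ↦ ((c * x ^ b : ℝ) : ℂ) * (x : ℂ) ^ (-(s + 1)))
      (volume.restrict (Ioi 1)) := by
    have h := integrable_ofReal_mul_cpow (g := fun x : ℝ ↦ x ^ b) (measurable_id.pow_const _)
      (σ₁ := (b + s.re) / 2) (s := s) (PsiOmega.integrableOn_rpow_rpow (by linarith)) (by linarith)
    have := h.const_mul (c : ℂ)
    refine this.congr (Eventually.of_forall fun x ↦ ?_)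
    push_cast; ring
  have hID : Integrable (fun x : ℝ ↦ ((η * dLog x : ℝ) : ℂ) * (x : ℂ) ^ (-(s + 1)))
      (volume.restrict (Ioi 1)) := by
    have hε : 0 < (s.re - 1) / 4 := by linarith
    have h := integrable_ofReal_mul_cpow measurable_dLog (σ₁ := (1 + s.re) / 2) (s := s)
      (integrableOn_rpow_of_abs_le_mul_rpow measurable_dLog (fun x hx ↦ abs_dLog_le_rpow hε hx)
        (by linarith)) (by linarith)
    have := h.const_mul (η : ℂ)
    refine this.congr (Eventually.of_forall fun x ↦ ?_)
    push_cast; ring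
  unfold cmp
  rw [mellinIoi_sub' hIk hID, mellinIoi_const_mul, mellinIoi_const_mul, mellinIoi_dLog hs,
    PsiOmega.mellinIoi_rpow (lt_of_le_of_lt hb hs)]
  field_simp

/-! ### Robin's Lemma 1 at a zero: `D(x) log x = Ω±(x^b)` for every `b < Re ρ₀` -/

/-- **Core step.** Let `ρ₀` be a zero of `ζ` with `Re ρ₀ > b > 0`, `η = ±1`, `c > 0`. Then
`η D(x) log x ≤ c x^b` cannot hold for all large `x`: otherwise `G = c x^b − η D log x ≥ 0` beyond
`X₀`, Landau's lemma continues `F(s) = ∫_1^∞ G x^{-s-1} dx = c/(s−b) − η((q−1)/s − Λ̃/s²)` to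
`Re s > b` through a primitive `Λ` of `ζ₁'/ζ₁ + q` on `{Re s > 1} ∪ {Re s > b/2, |Im s| < 2δ}`, and
`Λ_H = s²(η(F − c/(s−b)) + (q−1)/s)` is then a holomorphic logarithm of `ζ₁ e^{∫q}` on the whole
half-plane `Re s > b`, which contains the zero `ρ₀` of `ζ₁`: impossible.
[cite: Robin1984Toulouse, §4 Lemme 1 (proof, "le théorème de Landau"); MontgomeryVaughan2007, §15.1 Lemma 15.1, proof of Thm. 15.2] -/
theorem false_of_eventually_le {ρ₀ : ℂ} (h0 : riemannZeta ρ₀ = 0) {b : ℝ} (hb0 : 0 < b)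
    (hbρ : b < ρ₀.re) {c η : ℝ} (hη : η = 1 ∨ η = -1) (hc0 : 0 < c)
    (hev : ∀ᶠ x in atTop, η * dLog x ≤ c * x ^ b) : False := by
  -- (1) the zero
  have hre : 0 < ρ₀.re := hb0.trans hbρ
  have hρre1 : ρ₀.re < 1 := by
    by_contra h
    exact riemannZeta_ne_zero_of_one_le_re (not_lt.1 h) h0
  have hb1 : b < 1 := hbρ.trans hρre1
  have hγ : ρ₀.im ≠ 0 := im_ne_zero_of_riemannZeta_eq_zero h0 hre hρre1
  have hρ1 : ρ₀ ≠ 1 := by intro h; apply hγ; rw [h]; simp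
  have hζ₁0 : riemannZeta₁ ρ₀ = 0 := (riemannZeta₁_eq_zero_iff hρ1).2 h0
  have hηsq : (η : ℂ) * η = 1 := by rcases hη with rfl | rfl <;> push_cast <;> norm_num
  obtain ⟨δ, hδ, -, hgap⟩ := ZetaZeroSum.exists_gap_im
  -- (2) the non-negative function `G`
  obtain ⟨X₁, hX₁⟩ := eventually_atTop.1 hev
  set X₀ : ℝ := max X₁ 1 with hX₀def
  have hX₀ : 1 ≤ X₀ := le_max_right _ _
  set G : ℝ → ℝ := cmp c b η with hGdef
  have hGm : Measurable G := measurable_cmp c b η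
  have hpos : ∀ x, X₀ < x → 0 ≤ G x := fun x hx ↦ by
    have := hX₁ x ((le_max_left _ _).trans hx.le)
    simp only [hGdef, cmp]
    linarith
  have hGbs : ∀ x, 1 < x → |G x| ≤ (c + 8) * x ^ 2 := fun x hx ↦ abs_cmp_le hc0.le hb1.le hη hx
  have hint : IntegrableOn (fun x ↦ G x * x ^ (-((3 : ℝ) + 1))) (Ioi 1) :=
    integrableOn_rpow_of_abs_le_mul_sq hGm hGbs (by norm_num)
  -- (3) the primitive `Lam` on `U = region (b/2) δ`, and Landau's `W₀ = strip b δ ⊆ U`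
  obtain ⟨Lam, hLam, hLamEq⟩ :=
    exists_primitive_on_region (a := b / 2) (δ := δ) (by linarith) (by linarith) hδ hgap
  set W₀ : Set ℂ := strip b δ with hW₀
  have hW₀r : ∀ σ' : ℝ, b < σ' → σ' ≤ 3 + 1 → (σ' : ℂ) ∈ W₀ := by
    intro σ' h1 _
    refine ⟨by simpa using h1, ?_, ?_⟩
    · show -(2 * δ) < ((σ' : ℝ) : ℂ).im
      rw [ofReal_im]; linarith
    · show ((σ' : ℝ) : ℂ).im < 2 * δ
      rw [ofReal_im]; linarith
  have hW₀U : W₀ ⊆ region (b / 2) δ := fun s hs ↦ Or.inr ⟨by linarith [hs.1], hs.2.1, hs.2.2⟩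
  have hbU3 : ∀ s ∈ ({s : ℂ | (3 : ℝ) < s.re} ∪ W₀), b < s.re ∧ s ∈ region (b / 2) δ := by
    rintro s (hs | hs)
    · have hs' : (3 : ℝ) < s.re := hs
      exact ⟨by linarith, Or.inl (show (1 : ℝ) < s.re by linarith)⟩
    · exact ⟨hs.1, hW₀U hs⟩
  set Φ : ℂ → ℂ := fun s ↦ c / (s - b) - η * ((qFn s - 1) / s - Lam s / s ^ 2) with hΦ
  have hΦd : DifferentiableOn ℂ Φ ({s : ℂ | (3 : ℝ) < s.re} ∪ W₀) := by
    intro s hs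
    obtain ⟨hbs, hsU⟩ := hbU3 s hs
    have hs0 : s ≠ 0 := by intro h; rw [h] at hbs; simp at hbs; linarith
    have hsb : s ≠ (b : ℂ) := by intro h; rw [h] at hbs; simp at hbs
    have d0 : DifferentiableAt ℂ (fun z : ℂ ↦ (c : ℂ) / (z - b)) s :=
      (differentiableAt_const _).div (differentiableAt_id.sub_const _) (sub_ne_zero.2 hsb)
    have d1 : DifferentiableAt ℂ (fun z : ℂ ↦ (qFn z - 1) / z) s :=
      ((differentiable_qFn s).sub_const _).div differentiableAt_id hs0
    have d2 : DifferentiableAt ℂ (fun z : ℂ ↦ Lam z / z ^ 2) s :=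
      (hLam s hsU).differentiableAt.div (differentiableAt_id.pow 2) (pow_ne_zero 2 hs0)
    exact (d0.sub ((d1.sub d2).const_mul _)).differentiableWithinAt
  have hagree : EqOn Φ (mellinIoi G) {s : ℂ | (3 : ℝ) < s.re} := by
    intro s hs
    have hs' : (3 : ℝ) < s.re := hs
    rw [hGdef, mellinIoi_cmp hb1.le (by linarith)]
    simp only [hΦ]
    rw [hLamEq (show (1 : ℝ) < s.re by linarith)]
  -- (4) Landau's lemma
  have hI : ∀ σ : ℝ, b < σ → IntegrableOn (fun x ↦ G x * x ^ (-(σ + 1))) (Ioi 1) := fun σ hσ ↦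
    Landau.integrableOn_of_differentiableOn_union_convex hGm hint hX₀ hpos (by linarith : b < 3)
      (isOpen_strip b δ) (convex_strip b δ) hW₀r hΦd hagree hσ
  set F : ℂ → ℂ := mellinIoi G with hFdef
  have hFd : DifferentiableOn ℂ F {s : ℂ | b < s.re} := differentiableOn_mellinIoi_of_forall hGm hI
  -- (5) `Λ_H = s²(η(F − c/(s−b)) + (q−1)/s)` on `H = {Re s > b}`
  set LamH : ℂ → ℂ := fun s ↦ s ^ 2 * (η * (F s - c / (s - b)) + (qFn s - 1) / s) with hLamH
  have hLamHd : DifferentiableOn ℂ LamH {s : ℂ | b < s.re} := by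
    intro s hs
    have hbs : b < s.re := hs
    have hs0 : s ≠ 0 := by intro h; rw [h] at hbs; simp at hbs; linarith
    have hsb : s ≠ (b : ℂ) := by intro h; rw [h] at hbs; simp at hbs
    have d0 : DifferentiableAt ℂ (fun z : ℂ ↦ (c : ℂ) / (z - b)) s :=
      (differentiableAt_const _).div (differentiableAt_id.sub_const _) (sub_ne_zero.2 hsb)
    have d1 : DifferentiableAt ℂ (fun z : ℂ ↦ (qFn z - 1) / z) s :=
      ((differentiable_qFn s).sub_const _).div differentiableAt_id hs0
    have dF : DifferentiableAt ℂ F s := (hFd s hs).differentiableAt ((isOpen_re_gt b).mem_nhds hbs)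
    exact ((differentiableAt_id.pow 2).mul (((dF.sub d0).const_mul _).add d1)).differentiableWithinAt
  have hFdec : ∀ s : ℂ, 1 < s.re →
      F s = c / (s - b) - η * ((qFn s - 1) / s - lamTilde s / s ^ 2) := fun s hs ↦
    mellinIoi_cmp hb1.le hs
  have hLamH1 : EqOn LamH lamTilde {s : ℂ | 1 < s.re} := by
    intro s hs
    have hs' : 1 < s.re := hs
    have hs0 : s ≠ 0 := by rintro rfl; simp at hs'; linarith
    simp only [hLamH, hFdec s hs']
    have e1 : (η : ℂ) * (↑c / (s - ↑b) - ↑η * ((qFn s - 1) / s - lamTilde s / s ^ 2) - ↑c / (s - ↑b)) +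
        (qFn s - 1) / s = lamTilde s / s ^ 2 := by
      linear_combination (-((qFn s - 1) / s - lamTilde s / s ^ 2)) * hηsq
    rw [e1]
    field_simp
  set V : Set ℂ := {s : ℂ | 1 < s.re} ∪ W₀ with hV
  have hVo : IsOpen V := (isOpen_re_gt 1).union (isOpen_strip b δ)
  have h2W : (2 : ℂ) ∈ W₀ := by
    have := hW₀r 2 (by linarith) (by norm_num); simpa using this
  have h2re : (2 : ℂ) ∈ {s : ℂ | 1 < s.re} := by simp
  have hVpre : IsPreconnected V :=
    IsPreconnected.union (2 : ℂ) h2re h2W (convex_halfSpace_re_gt 1).isPreconnected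
      (convex_strip b δ).isPreconnected
  have hVH : V ⊆ {s : ℂ | b < s.re} := by
    rintro s (hs | hs)
    · have hs' : 1 < s.re := hs
      show b < s.re; linarith
    · exact hs.1
  have hVU : V ⊆ region (b / 2) δ := by
    rintro s (hs | hs)
    · exact Or.inl hs
    · exact hW₀U hs
  have hEqV : EqOn LamH Lam V := by
    have h1 : AnalyticOnNhd ℂ LamH V := (hLamHd.mono hVH).analyticOnNhd hVo
    have hLamV : DifferentiableOn ℂ Lam V := fun s hs ↦
      (hLam s (hVU hs)).differentiableAt.differentiableWithinAt
    have h2 : AnalyticOnNhd ℂ Lam V := hLamV.analyticOnNhd hVo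
    refine h1.eqOn_of_preconnected_of_eventuallyEq h2 hVpre (Or.inl h2re) ?_
    filter_upwards [(isOpen_re_gt 1).mem_nhds h2re] with s hs
    rw [hLamH1 hs, hLamEq hs]
  -- (6) `Ξ = ζ₁ exp(−(Λ_H − ∫q))` is constant on `H`
  obtain ⟨etil, hetil⟩ := differentiable_qFn.isExactOn_univ
  set Ξ : ℂ → ℂ := fun s ↦ riemannZeta₁ s * Complex.exp (-(LamH s - etil s)) with hΞ
  have hetild : Differentiable ℂ etil := fun z ↦ (hetil z (mem_univ _)).differentiableAt
  have hΞd : DifferentiableOn ℂ Ξ {s : ℂ | b < s.re} := fun s hs ↦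
    ((differentiable_riemannZeta₁ s).differentiableWithinAt).mul
      (((hLamHd s hs).sub (hetild s).differentiableWithinAt).neg.cexp)
  have hΞ' : ∀ s : ℂ, 1 < s.re → HasDerivAt Ξ 0 s := by
    intro s hs
    have hs1 : s ≠ 1 := by rintro rfl; simp at hs
    have hζ : riemannZeta₁ s ≠ 0 := by
      rw [Ne, riemannZeta₁_eq_zero_iff hs1]; exact riemannZeta_ne_zero_of_one_lt_re hs
    have hL : HasDerivAt LamH (logDeriv riemannZeta₁ s + qFn s) s := by
      refine (hLam s (Or.inl hs)).congr_of_eventuallyEq ?_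
      filter_upwards [hVo.mem_nhds (Or.inl hs)] with z hz using hEqV hz
    have hz : HasDerivAt riemannZeta₁ (deriv riemannZeta₁ s) s :=
      (differentiable_riemannZeta₁ s).hasDerivAt
    have he : HasDerivAt (fun z ↦ Complex.exp (-(LamH z - etil z)))
        (Complex.exp (-(LamH s - etil s)) * -(logDeriv riemannZeta₁ s + qFn s - qFn s)) s :=
      ((hL.sub (hetil s (mem_univ _))).neg).cexp
    have hprod : HasDerivAt Ξ (deriv riemannZeta₁ s * Complex.exp (-(LamH s - etil s)) +
        riemannZeta₁ s * (Complex.exp (-(LamH s - etil s)) *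
          -(logDeriv riemannZeta₁ s + qFn s - qFn s))) s := hz.mul he
    have hval : deriv riemannZeta₁ s * Complex.exp (-(LamH s - etil s)) +
        riemannZeta₁ s * (Complex.exp (-(LamH s - etil s)) *
          -(logDeriv riemannZeta₁ s + qFn s - qFn s)) = 0 := by
      rw [logDeriv_apply]
      field_simp
      ring
    rw [hval] at hprod
    exact hprod
  have h2H : (2 : ℂ) ∈ {s : ℂ | b < s.re} := by show b < (2 : ℂ).re; norm_num; linarith
  have hΞconst : ∀ s ∈ {s : ℂ | b < s.re}, Ξ s = Ξ 2 := by
    have hΞa : AnalyticOnNhd ℂ Ξ {s : ℂ | b < s.re} := hΞd.analyticOnNhd (isOpen_re_gt b)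
    have hd0 : deriv Ξ =ᶠ[𝓝 (2 : ℂ)] 0 := by
      filter_upwards [(isOpen_re_gt 1).mem_nhds h2re] with z hz using (hΞ' z hz).deriv
    have hdz : EqOn (deriv Ξ) 0 {s : ℂ | b < s.re} :=
      hΞa.deriv.eqOn_zero_of_preconnected_of_eventuallyEq_zero
        (convex_halfSpace_re_gt b).isPreconnected h2H hd0
    exact fun s hs ↦ (isOpen_re_gt b).is_const_of_deriv_eq_zero
      (convex_halfSpace_re_gt b).isPreconnected hΞd hdz hs h2H
  have hΞ2 : Ξ 2 ≠ 0 := by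
    have hζ2 : riemannZeta₁ 2 ≠ 0 := by
      rw [Ne, riemannZeta₁_eq_zero_iff (by norm_num)]
      exact riemannZeta_ne_zero_of_one_lt_re (by norm_num)
    exact mul_ne_zero hζ2 (Complex.exp_ne_zero _)
  -- (7) but `ρ₀ ∈ H` is a zero of `ζ₁`
  have hρH : ρ₀ ∈ {s : ℂ | b < s.re} := hbρ
  have h := hΞconst ρ₀ hρH
  simp only [hΞ, hζ₁0, zero_mul] at h
  exact hΞ2 h.symm

/-- **Robin 1984 (Toulouse), Lemma 1 (`k = 1`), at a zero.** For every zero `ρ₀` of `ζ`, every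
`0 < b < Re ρ₀` and every `c > 0`: `D(x) log x ≥ c x^b` for arbitrarily large `x` and
`D(x) log x ≤ −c x^b` for arbitrarily large `x`, where `D(x) log x = (ψ(x) − x) − (Π(x) − L(x)) log x`
(Robin: "`D(x;k,l) log x − a x^ξ log x` change de signe" for every `ξ` below the real part of a zero).
[cite: Robin1984Toulouse, §4 Lemme 1] -/
theorem frequently_le_dLog_and_dLog_le {ρ₀ : ℂ} (h0 : riemannZeta ρ₀ = 0) {b : ℝ} (hb0 : 0 < b)
    (hbρ : b < ρ₀.re) {c : ℝ} (hc0 : 0 < c) :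
    (∃ᶠ x in atTop, c * x ^ b ≤ dLog x) ∧ (∃ᶠ x in atTop, dLog x ≤ -(c * x ^ b)) := by
  constructor
  · by_contra h
    refine false_of_eventually_le h0 hb0 hbρ (Or.inl rfl) hc0 ?_
    filter_upwards [not_frequently.1 h] with x hx
    rw [one_mul]
    exact (not_le.1 hx).le
  · by_contra h
    refine false_of_eventually_le h0 hb0 hbρ (Or.inr rfl) hc0 ?_
    filter_upwards [not_frequently.1 h] with x hx
    have := not_le.1 hx
    linarith

end Landau

section Structure

/-- `Π(x) = ∑_{n ≤ x} Λ(n)/log n` (the first summand of `PiLi.piSubLi`). [cite: MontgomeryVaughan2007, §15.1] -/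
def primePi (x : ℝ) : ℝ := ∑ n ∈ Finset.Ioc 0 ⌊x⌋₊, Λ n / Real.log n

/-- `P = Π − L`. [folklore] -/
private theorem piSubLi_eq (x : ℝ) : piSubLi x = primePi x - offsetLogIntegral (max 2 x) := rfl

/-- Robin's `D(x) = (ψ(x) − x)/log x − (Π(x) − L(x))` (his `D(x;1,1)`, the linearisation of
`B(x) = A(x) = li(θ(x)) − π(x)`; written with `ψ, Π` — the prime-power corrections are `O(√x)`).
[cite: Robin1984Toulouse, §4 (13)] -/
def robinD (x : ℝ) : ℝ := (ψ x - x) / Real.log x - piSubLi x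

/-- `D(x) log x = dLog x` for `x > 1`. [folklore] -/
private theorem dLog_eq_robinD_mul_log {x : ℝ} (hx : 1 < x) : dLog x = robinD x * Real.log x := by
  have hl : Real.log x ≠ 0 := (Real.log_pos hx).ne'
  unfold dLog robinD
  field_simp

/-- The smooth piece `φ_m(t) = (ψ(m) − t)/log t − Π(m) + L(t)` of `D` on `[m, m+1]` (Robin: "`y` est
continue et dérivable sur tout intervalle `]r, r'[`"). [cite: Robin1984Toulouse, §4 (proof of Lemme 2)] -/
def piece (m : ℕ) (t : ℝ) : ℝ := (ψ m - t) / Real.log t - primePi m + offsetLogIntegral t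

/-! ### Step-function bookkeeping -/

/-- `⌊t⌋ = m` on `[m, m+1)`. [folklore] -/
private theorem floor_eq_of_mem_Ico {m : ℕ} {t : ℝ} (ht : t ∈ Ico (m : ℝ) (m + 1)) : ⌊t⌋₊ = m :=
  (Nat.floor_eq_iff ((Nat.cast_nonneg m).trans ht.1)).2 ⟨ht.1, ht.2⟩

/-- `ψ` is constant on `[m, m+1)`. [folklore] -/
private theorem psi_eq_of_mem_Ico {m : ℕ} {t : ℝ} (ht : t ∈ Ico (m : ℝ) (m + 1)) : ψ t = ψ m := by
  rw [Chebyshev.psi_eq_psi_coe_floor t, floor_eq_of_mem_Ico ht]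

/-- `Π` is constant on `[m, m+1)`. [folklore] -/
private theorem primePi_eq_of_mem_Ico {m : ℕ} {t : ℝ} (ht : t ∈ Ico (m : ℝ) (m + 1)) :
    primePi t = primePi m := by
  unfold primePi
  rw [floor_eq_of_mem_Ico ht, Nat.floor_natCast]

/-- `ψ(m+1) = ψ(m) + Λ(m+1)`. [folklore] -/
private theorem psi_natCast_succ (m : ℕ) : ψ ((m + 1 : ℕ) : ℝ) = ψ (m : ℝ) + Λ (m + 1) := by
  rw [Chebyshev.psi, Chebyshev.psi, Nat.floor_natCast, Nat.floor_natCast,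
    Finset.sum_Ioc_succ_top (Nat.zero_le m)]

/-- `Π(m+1) = Π(m) + Λ(m+1)/log(m+1)`. [folklore] -/
private theorem primePi_natCast_succ (m : ℕ) :
    primePi ((m + 1 : ℕ) : ℝ) = primePi m + Λ (m + 1) / Real.log ((m + 1 : ℕ) : ℝ) := by
  rw [primePi, primePi, Nat.floor_natCast, Nat.floor_natCast,
    Finset.sum_Ioc_succ_top (Nat.zero_le m)]

/-- `D = φ_m` on `[m, m+1)` (`m ≥ 2`). [cite: Robin1984Toulouse, §4 (proof of Lemme 2)] -/
theorem robinD_eq_piece_of_mem_Ico {m : ℕ} (hm : 2 ≤ m) {t : ℝ} (ht : t ∈ Ico (m : ℝ) (m + 1)) :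
    robinD t = piece m t := by
  have h2 : (2 : ℝ) ≤ t := le_trans (by exact_mod_cast hm) ht.1
  unfold robinD piece
  rw [piSubLi_eq, psi_eq_of_mem_Ico ht, primePi_eq_of_mem_Ico ht, max_eq_right h2]
  ring

/-- `D(m+1) = φ_m(m+1)`: the jumps of `ψ/log` and of `Π` at `m+1` cancel (`m ≥ 2`; Robin: "`y` est
continue"). [cite: Robin1984Toulouse, §4 (proof of Lemme 2)] -/
theorem robinD_natCast_succ_eq_piece {m : ℕ} (hm : 2 ≤ m) :
    robinD ((m + 1 : ℕ) : ℝ) = piece m ((m + 1 : ℕ) : ℝ) := by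
  have h2 : (2 : ℝ) ≤ ((m + 1 : ℕ) : ℝ) := by exact_mod_cast (by omega : 2 ≤ m + 1)
  have hlog : Real.log ((m + 1 : ℕ) : ℝ) ≠ 0 := (Real.log_pos (by linarith)).ne'
  unfold robinD piece
  rw [piSubLi_eq, max_eq_right h2, psi_natCast_succ, primePi_natCast_succ]
  field_simp
  ring

/-- `D = φ_m` on the CLOSED interval `[m, m+1]` (`m ≥ 2`). [cite: Robin1984Toulouse, §4 (proof of Lemme 2)] -/
theorem robinD_eqOn_Icc {m : ℕ} (hm : 2 ≤ m) : EqOn robinD (piece m) (Icc (m : ℝ) (m + 1)) := by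
  intro t ht
  rcases ht.2.lt_or_eq with h | h
  · exact robinD_eq_piece_of_mem_Ico hm ⟨ht.1, h⟩
  · have : t = ((m + 1 : ℕ) : ℝ) := by rw [h, Nat.cast_add, Nat.cast_one]
    rw [this]
    exact robinD_natCast_succ_eq_piece hm

/-- `φ_m'(t) = (t − ψ(m))/(t log²t)` for `t > 1` (Robin (15)). [cite: Robin1984Toulouse, §4 (15)] -/
theorem hasDerivAt_piece (m : ℕ) {t : ℝ} (ht : 1 < t) :
    HasDerivAt (piece m) ((t - ψ m) / (t * Real.log t ^ 2)) t := by
  have ht0 : t ≠ 0 := by linarith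
  have hlog : Real.log t ≠ 0 := (Real.log_pos ht).ne'
  have h1 : HasDerivAt (fun u : ℝ ↦ (ψ m - u) / Real.log u)
      (((-1) * Real.log t - (ψ m - t) * t⁻¹) / Real.log t ^ 2) t :=
    ((hasDerivAt_id' t).const_sub (ψ (m : ℝ))).div (Real.hasDerivAt_log ht0) hlog
  have h2 : HasDerivAt offsetLogIntegral (Real.log t)⁻¹ t := hasDerivAt_offsetLogIntegral_holds ht
  have h : HasDerivAt (piece m)
      (((-1) * Real.log t - (ψ m - t) * t⁻¹) / Real.log t ^ 2 + (Real.log t)⁻¹) t :=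
    (h1.sub_const (primePi m)).add h2
  refine h.congr_deriv ?_
  field_simp
  ring

/-- Continuity of `D` on `[2, ∞)` (the jumps cancel at the integers). [cite: Robin1984Toulouse, §4 (proof of Lemme 2)] -/
theorem continuousOn_robinD : ContinuousOn robinD (Ici 2) := by
  intro t₀ ht₀
  have ht₀2 : (2 : ℝ) ≤ t₀ := ht₀
  have hpc : ∀ m : ℕ, ∀ t : ℝ, 1 < t → ContinuousAt (piece m) t := fun m t ht ↦
    (hasDerivAt_piece m ht).continuousAt
  -- continuity within `[m, m+1]` at each of its points (`m ≥ 2`)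
  have hin : ∀ m : ℕ, 2 ≤ m → ∀ t ∈ Icc (m : ℝ) (m + 1),
      ContinuousWithinAt robinD (Icc (m : ℝ) (m + 1)) t := by
    intro m hm t ht
    have hm' : (2 : ℝ) ≤ m := by exact_mod_cast hm
    have ht1 : 1 < t := by linarith [ht.1]
    exact ((hpc m t ht1).continuousWithinAt).congr (fun u hu ↦ robinD_eqOn_Icc hm hu)
      (robinD_eqOn_Icc hm ht)
  obtain ⟨m, hm⟩ : ∃ m : ℕ, m = ⌊t₀⌋₊ := ⟨_, rfl⟩
  have hm2 : 2 ≤ m := hm ▸ Nat.le_floor ht₀2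
  have hmt : (m : ℝ) ≤ t₀ := hm ▸ Nat.floor_le (by linarith)
  have htm : t₀ < m + 1 := hm ▸ Nat.lt_floor_add_one t₀
  have hright : ContinuousWithinAt robinD (Icc (m : ℝ) (m + 1)) t₀ := hin m hm2 t₀ ⟨hmt, htm.le⟩
  rcases hmt.lt_or_eq with hlt | heq
  · -- `t₀` is interior to `[m, m+1]`
    exact hright.mono_of_mem_nhdsWithin (mem_nhdsWithin_of_mem_nhds (Icc_mem_nhds hlt htm))
  · rcases (show m = 2 ∨ 3 ≤ m by omega) with h2 | h3
    · -- `t₀ = 2`: only the right side matters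
      have ht2 : t₀ = 2 := by rw [← heq, h2]; norm_num
      have hmem : Icc (m : ℝ) (m + 1) ∈ 𝓝[Ici 2] t₀ := by
        rw [ht2, h2]
        push_cast
        exact Icc_mem_nhdsGE (by norm_num)
      exact hright.mono_of_mem_nhdsWithin hmem
    · -- `t₀ = m ≥ 3`: glue `[m-1, m]` and `[m, m+1]`
      obtain ⟨k, hk1⟩ : ∃ k : ℕ, k + 1 = m := ⟨m - 1, by omega⟩
      have hk2 : 2 ≤ k := by omega
      have hkR : (k : ℝ) + 1 = m := by exact_mod_cast hk1
      have hleft : ContinuousWithinAt robinD (Icc (k : ℝ) (k + 1)) t₀ :=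
        hin k hk2 t₀ ⟨by linarith, by linarith⟩
      have hboth := continuousWithinAt_union.2 ⟨hleft, hright⟩
      refine hboth.mono_of_mem_nhdsWithin (mem_nhdsWithin_of_mem_nhds ?_)
      have hsub : Ioo (k : ℝ) (m + 1) ⊆ Icc (k : ℝ) (k + 1) ∪ Icc (m : ℝ) (m + 1) := by
        intro x hx
        by_cases hx1 : x ≤ k + 1
        · exact Or.inl ⟨hx.1.le, hx1⟩
        · exact Or.inr ⟨by linarith, hx.2.le⟩
      exact Filter.mem_of_superset (Ioo_mem_nhds (by linarith) htm) hsub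

/-- The right derivative of `D` at every `t ≥ 2`: `(t − ψ(t))/(t log² t)`. [cite: Robin1984Toulouse, §4 (15)] -/
theorem hasDerivWithinAt_robinD {t : ℝ} (ht : 2 ≤ t) :
    HasDerivWithinAt robinD ((t - ψ t) / (t * Real.log t ^ 2)) (Ioi t) t := by
  set m := ⌊t⌋₊ with hm
  have hm2 : 2 ≤ m := Nat.le_floor ht
  have hmt : (m : ℝ) ≤ t := Nat.floor_le (by linarith)
  have htm : t < m + 1 := Nat.lt_floor_add_one t
  have hψ : ψ t = ψ m := psi_eq_of_mem_Ico ⟨hmt, htm⟩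
  have h := (hasDerivAt_piece m (by linarith : 1 < t)).hasDerivWithinAt (s := Ioi t)
  rw [← hψ] at h
  refine h.congr_of_eventuallyEq ?_ (robinD_eqOn_Icc hm2 ⟨hmt, htm.le⟩)
  have hmem : Ioi t ∩ Iio ((m : ℝ) + 1) ∈ 𝓝[Ioi t] t :=
    inter_mem_nhdsWithin _ (Iio_mem_nhds htm)
  filter_upwards [hmem] with u hu
  exact robinD_eqOn_Icc hm2 ⟨hmt.trans (le_of_lt hu.1), le_of_lt hu.2⟩

/-- The derivative integrand `f(t) = (t − ψ(t))/(t log² t)` of `D`. [cite: Robin1984Toulouse, §4 (15)] -/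
def dDeriv (t : ℝ) : ℝ := (t - ψ t) / (t * Real.log t ^ 2)

/-- Measurability of `f`. [folklore] -/
private theorem measurable_dDeriv : Measurable dDeriv := by
  unfold dDeriv
  exact (measurable_id.sub Nicolas.measurable_psi).div
    (measurable_id.mul (Real.measurable_log.pow_const 2))

/-- `|f(t)| ≤ 6/log² 2` for `t ≥ 2`. [folklore] -/
private theorem abs_dDeriv_le {t : ℝ} (ht : 2 ≤ t) : |dDeriv t| ≤ 6 / Real.log 2 ^ 2 := by
  have ht0 : 0 < t := by linarith
  have hl2 : 0 < Real.log 2 := Real.log_pos one_lt_two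
  have hlt : Real.log 2 ≤ Real.log t := Real.log_le_log two_pos ht
  have hlt0 : 0 < Real.log t := hl2.trans_le hlt
  have hψ : |t - ψ t| ≤ 6 * t := by
    rw [abs_sub_comm]; exact Nicolas.abs_psi_sub_self_le ht0.le
  unfold dDeriv
  rw [abs_div, abs_of_pos (by positivity : 0 < t * Real.log t ^ 2), div_le_div_iff₀ (by positivity) (by positivity)]
  have h1 : Real.log 2 ^ 2 ≤ Real.log t ^ 2 := pow_le_pow_left₀ hl2.le hlt 2
  calc |t - ψ t| * Real.log 2 ^ 2 ≤ 6 * t * Real.log t ^ 2 :=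
        mul_le_mul hψ h1 (by positivity) (by positivity)
    _ = 6 * (t * Real.log t ^ 2) := by ring

/-- `f` is integrable on every `[x₁, x₂] ⊆ [2, ∞)`. [folklore] -/
private theorem intervalIntegrable_dDeriv {x₁ x₂ : ℝ} (h1 : 2 ≤ x₁) (h12 : x₁ ≤ x₂) :
    IntervalIntegrable dDeriv volume x₁ x₂ := by
  rw [intervalIntegrable_iff_integrableOn_Ioc_of_le h12]
  refine Measure.integrableOn_of_bounded measure_Ioc_lt_top.ne measurable_dDeriv.aestronglyMeasurable
    (M := 6 / Real.log 2 ^ 2) ?_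
  rw [ae_restrict_iff' measurableSet_Ioc]
  refine Eventually.of_forall fun t ht ↦ ?_
  rw [Real.norm_eq_abs]
  exact abs_dDeriv_le (h1.trans ht.1.le)

/-- **`D(x₂) − D(x₁) = ∫_{x₁}^{x₂} (t − ψ(t))/(t log² t) dt`** for `2 ≤ x₁ ≤ x₂` (FTC for the
continuous, right-differentiable `D`). [cite: Robin1984Toulouse, §4 (15)–(16)] -/
theorem integral_dDeriv_eq {x₁ x₂ : ℝ} (h1 : 2 ≤ x₁) (h12 : x₁ ≤ x₂) :
    ∫ t in x₁..x₂, dDeriv t = robinD x₂ - robinD x₁ :=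
  intervalIntegral.integral_eq_sub_of_hasDeriv_right_of_le h12
    (continuousOn_robinD.mono fun t ht ↦ (h1.trans ht.1 : (2 : ℝ) ≤ t))
    (fun _ ht ↦ hasDerivWithinAt_robinD (h1.trans ht.1.le))
    (intervalIntegrable_dDeriv h1 h12)

/-! ### `li` comparisons -/

/-- `li(b) − li(a) ≤ (b − a)/log a` for `1 < a ≤ b` (`li' = 1/log` is decreasing; the companion of the
tree's `sub_div_log_le_logIntegral_sub`, Abramowitz–Stegun 5.1.3). [cite: Nicolas2017, proof of Prop. 3.5] -/
theorem logIntegral_sub_le_sub_div_log {a b : ℝ} (ha : 1 < a) (hab : a ≤ b) :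
    logIntegral b - logIntegral a ≤ (b - a) / Real.log a := by
  have hD : Convex ℝ (Icc a b) := convex_Icc a b
  have hderiv : ∀ x ∈ Icc a b, HasDerivAt logIntegral (Real.log x)⁻¹ x := fun x hx =>
    hasDerivAt_logIntegral_holds (lt_of_lt_of_le ha hx.1)
  have hcont : ContinuousOn logIntegral (Icc a b) := fun x hx =>
    (hderiv x hx).continuousAt.continuousWithinAt
  have hdiff : DifferentiableOn ℝ logIntegral (interior (Icc a b)) := fun x hx =>
    (hderiv x (interior_subset hx)).differentiableAt.differentiableWithinAt
  have hle : ∀ x ∈ interior (Icc a b), deriv logIntegral x ≤ (Real.log a)⁻¹ := by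
    intro x hx
    have hx' : x ∈ Icc a b := interior_subset hx
    rw [(hderiv x hx').deriv]
    exact inv_anti₀ (Real.log_pos ha) (Real.log_le_log (by linarith) hx'.1)
  have h := hD.image_sub_le_mul_sub_of_deriv_le hcont hdiff hle a (left_mem_Icc.mpr hab) b
    (right_mem_Icc.mpr hab) hab
  rw [div_eq_inv_mul]
  exact h

/-- Concavity of `li`: `li(y) − li(x) ≤ (y − x)/log x` for `x, y > 1` (Robin: "`B(x;k,l) ≤ D(x;k,l)`").
[cite: Robin1984Toulouse, §4 (13)] -/
theorem logIntegral_sub_le {x y : ℝ} (hx : 1 < x) (hy : 1 < y) :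
    logIntegral y - logIntegral x ≤ (y - x) / Real.log x := by
  rcases le_total x y with h | h
  · exact logIntegral_sub_le_sub_div_log hx h
  · have := sub_div_log_le_logIntegral_sub hy h
    have e : (x - y) / Real.log x = -((y - x) / Real.log x) := by ring
    linarith

/-- `u log² u` is monotone on `(1, ∞)`. [folklore] -/
private theorem mul_log_sq_le {u v : ℝ} (hu : 1 < u) (huv : u ≤ v) :
    u * Real.log u ^ 2 ≤ v * Real.log v ^ 2 := by
  have hl : 0 < Real.log u := Real.log_pos hu
  have hll : Real.log u ≤ Real.log v := Real.log_le_log (by linarith) huv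
  exact mul_le_mul huv (pow_le_pow_left₀ hl.le hll 2) (by positivity) (by linarith)

/-- **The concavity gap** (Robin (13): `B = D + O(E²)`): `(y − x)/log x − (li y − li x) ≤ (y − x)²/(u log² u)`
whenever `1 < u ≤ min(x, y)`. [cite: Robin1984Toulouse, §4 (13)] -/
theorem gap_le {x y u : ℝ} (hu : 1 < u) (hux : u ≤ x) (huy : u ≤ y) :
    (y - x) / Real.log x - (logIntegral y - logIntegral x) ≤ (y - x) ^ 2 / (u * Real.log u ^ 2) := by
  have hx : 1 < x := lt_of_lt_of_le hu hux
  have hy : 1 < y := lt_of_lt_of_le hu huy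
  have hlx : 0 < Real.log x := Real.log_pos hx
  have hly : 0 < Real.log y := Real.log_pos hy
  have hden : 0 < u * Real.log u ^ 2 := by have := Real.log_pos hu; positivity
  rcases le_total x y with h | h
  · -- `x ≤ y`
    have h1 : (y - x) / Real.log y ≤ logIntegral y - logIntegral x :=
      sub_div_log_le_logIntegral_sub hx h
    have hlog : Real.log y - Real.log x ≤ (y - x) / x := by
      rw [← Real.log_div (by linarith) (by linarith)]
      have := Real.log_le_sub_one_of_pos (show 0 < y / x by positivity)
      have e : y / x - 1 = (y - x) / x := by field_simp
      linarith
    have hll : Real.log x ≤ Real.log y := Real.log_le_log (by linarith) h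
    have e1 : (y - x) / Real.log x - (y - x) / Real.log y =
        (y - x) * (Real.log y - Real.log x) / (Real.log x * Real.log y) := by
      field_simp
    have e2 : (y - x) * ((y - x) / x) / (Real.log x * Real.log x) = (y - x) ^ 2 / (x * Real.log x ^ 2) := by
      field_simp
    calc (y - x) / Real.log x - (logIntegral y - logIntegral x)
        ≤ (y - x) / Real.log x - (y - x) / Real.log y := by linarith
      _ = (y - x) * (Real.log y - Real.log x) / (Real.log x * Real.log y) := e1
      _ ≤ (y - x) * ((y - x) / x) / (Real.log x * Real.log y) :=
          div_le_div_of_nonneg_right (mul_le_mul_of_nonneg_left hlog (by linarith)) (by positivity)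
      _ ≤ (y - x) * ((y - x) / x) / (Real.log x * Real.log x) :=
          div_le_div_of_nonneg_left (mul_nonneg (by linarith) (div_nonneg (by linarith) (by linarith)))
            (by positivity) (mul_le_mul_of_nonneg_left hll hlx.le)
      _ = (y - x) ^ 2 / (x * Real.log x ^ 2) := e2
      _ ≤ (y - x) ^ 2 / (u * Real.log u ^ 2) :=
          div_le_div_of_nonneg_left (sq_nonneg _) hden (mul_log_sq_le hu hux)
  · -- `y ≤ x`
    have h1 : logIntegral x - logIntegral y ≤ (x - y) / Real.log y :=
      logIntegral_sub_le_sub_div_log hy h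
    have hlog : Real.log x - Real.log y ≤ (x - y) / y := by
      rw [← Real.log_div (by linarith) (by linarith)]
      have := Real.log_le_sub_one_of_pos (show 0 < x / y by positivity)
      have e : x / y - 1 = (x - y) / y := by field_simp
      linarith
    have hll : Real.log y ≤ Real.log x := Real.log_le_log (by linarith) h
    have e1 : (x - y) / Real.log y - (x - y) / Real.log x =
        (x - y) * (Real.log x - Real.log y) / (Real.log x * Real.log y) := by
      field_simp
    have e2 : (x - y) * ((x - y) / y) / (Real.log y * Real.log y) = (y - x) ^ 2 / (y * Real.log y ^ 2) := by
      field_simp; ring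
    calc (y - x) / Real.log x - (logIntegral y - logIntegral x)
        = (logIntegral x - logIntegral y) - (x - y) / Real.log x := by ring
      _ ≤ (x - y) / Real.log y - (x - y) / Real.log x := by linarith
      _ = (x - y) * (Real.log x - Real.log y) / (Real.log x * Real.log y) := e1
      _ ≤ (x - y) * ((x - y) / y) / (Real.log x * Real.log y) :=
          div_le_div_of_nonneg_right (mul_le_mul_of_nonneg_left hlog (by linarith)) (by positivity)
      _ ≤ (x - y) * ((x - y) / y) / (Real.log y * Real.log y) :=
          div_le_div_of_nonneg_left (mul_nonneg (by linarith) (div_nonneg (by linarith) (by linarith)))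
            (by positivity) (mul_le_mul_of_nonneg_right hll hly.le)
      _ = (y - x) ^ 2 / (y * Real.log y ^ 2) := e2
      _ ≤ (y - x) ^ 2 / (u * Real.log u ^ 2) :=
          div_le_div_of_nonneg_left (sq_nonneg _) hden (mul_log_sq_le hu huy)

/-! ### `A(x) = li(θ(x)) − π(x)` against `D(x)` -/

/-- **The decomposition of `A − D`** (`x ≥ 2`):
`A(x) = D(x) + li(2) − (ψ(x) − θ(x))/log x + (Π(x) − π(x)) − gap(x)`,
`gap(x) = (θ(x) − x)/log x − (li(θ(x)) − li(x))` (Robin's (1), (13) made exact). [cite: Robin1984Toulouse, §4 (13)] -/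
theorem liThetaSubPi_eq_robinD_add {x : ℝ} (hx : 2 ≤ x) :
    liThetaSubPi x = robinD x + logIntegral 2 - (ψ x - θ x) / Real.log x +
      (primePi x - (Nat.primeCounting ⌊x⌋₊ : ℝ)) -
      ((θ x - x) / Real.log x - (logIntegral (θ x) - logIntegral x)) := by
  have hx1 : 1 < x := by linarith
  have hlog : Real.log x ≠ 0 := (Real.log_pos hx1).ne'
  have hli : logIntegral x = offsetLogIntegral x + logIntegral 2 :=
    logIntegral_eq_offsetLogIntegral_add_logIntegral_two hx1
  rw [liThetaSubPi_def, robinD, piSubLi_eq, max_eq_right hx, hli]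
  field_simp
  ring

/-- Upper bound: `A(x) ≤ D(x) + li 2 + 2√x log x/log 2` (`x ≥ 2`, `θ(x) > 1`; Robin: "`B ≤ D`"). [cite: Robin1984Toulouse, §4 (13)] -/
theorem liThetaSubPi_le {x : ℝ} (hx : 2 ≤ x) (hθ : 1 < θ x) :
    liThetaSubPi x ≤ robinD x + logIntegral 2 + 2 * Real.sqrt x * Real.log x / Real.log 2 := by
  have hx1 : 1 < x := by linarith
  rw [liThetaSubPi_eq_robinD_add hx]
  have h1 : 0 ≤ (ψ x - θ x) / Real.log x :=
    div_nonneg (sub_nonneg.2 (Chebyshev.theta_le_psi x)) (Real.log_pos hx1).le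
  have h2 : primePi x - (Nat.primeCounting ⌊x⌋₊ : ℝ) ≤ 2 * Real.sqrt x * Real.log x / Real.log 2 :=
    PiOmega.primePowerPi_sub_primeCounting_le_sqrt hx1.le
  have h3 : 0 ≤ (θ x - x) / Real.log x - (logIntegral (θ x) - logIntegral x) := by
    have := logIntegral_sub_le hx1 hθ
    linarith
  linarith

/-- Lower bound: `A(x) ≥ D(x) + li 2 − 2√x − (θ(x) − x)²/(u log² u)` for `1 < u ≤ min(x, θ(x))`,
`x ≥ 2` (Robin: "`B = D + O(x^{2Θ−1})`", here with the quadratic error kept explicit). [cite: Robin1984Toulouse, §4 (13)] -/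
theorem le_liThetaSubPi {x u : ℝ} (hx : 2 ≤ x) (hu : 1 < u) (hux : u ≤ x) (huθ : u ≤ θ x) :
    robinD x + logIntegral 2 - 2 * Real.sqrt x - (θ x - x) ^ 2 / (u * Real.log u ^ 2) ≤
      liThetaSubPi x := by
  have hx1 : 1 < x := by linarith
  have hlog : 0 < Real.log x := Real.log_pos hx1
  rw [liThetaSubPi_eq_robinD_add hx]
  have h1 : (ψ x - θ x) / Real.log x ≤ 2 * Real.sqrt x := by
    rw [div_le_iff₀ hlog]
    have := (le_abs_self _).trans (Chebyshev.abs_psi_sub_theta_le_sqrt_mul_log hx1.le)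
    linarith
  have h2 : 0 ≤ primePi x - (Nat.primeCounting ⌊x⌋₊ : ℝ) :=
    PiOmega.primePowerPi_sub_primeCounting_nonneg x
  have h3 := gap_le hu hux huθ
  linarith


/-! ### Eventual inequalities `C x^p log^k x ≤ x^q` (`p < q`) -/

/-- For `p < q`, any constant `C` and any `k`: `C x^p (log x)^k ≤ x^q` for all large `x`. [folklore] -/
private theorem eventually_mul_rpow_mul_log_pow_le (C p q : ℝ) (k : ℕ) (hpq : p < q) :
    ∀ᶠ x : ℝ in atTop, C * x ^ p * Real.log x ^ k ≤ x ^ q := by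
  have h1 : (fun x : ℝ ↦ Real.log x ^ (k : ℝ)) =o[atTop] fun x ↦ x ^ (q - p) :=
    isLittleO_log_rpow_rpow_atTop (k : ℝ) (by linarith)
  have h2 : ∀ᶠ x : ℝ in atTop, ‖Real.log x ^ (k : ℝ)‖ ≤ 1 / (|C| + 1) * ‖x ^ (q - p)‖ :=
    h1.bound (by positivity)
  filter_upwards [h2, eventually_ge_atTop (1 : ℝ)] with x hx hx1
  have hx0 : 0 < x := by linarith
  have hlog : 0 ≤ Real.log x := Real.log_nonneg hx1
  rw [Real.rpow_natCast, Real.norm_of_nonneg (pow_nonneg hlog _),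
    Real.norm_of_nonneg (Real.rpow_nonneg hx0.le _)] at hx
  have hC : C ≤ |C| := le_abs_self C
  have hC0 : 0 ≤ |C| := abs_nonneg C
  have hxp : 0 ≤ x ^ p := Real.rpow_nonneg hx0.le _
  have hlk : 0 ≤ Real.log x ^ k := pow_nonneg hlog _
  have hsplit : x ^ q = x ^ p * x ^ (q - p) := by
    rw [← Real.rpow_add hx0]; congr 1; ring
  have hfrac : |C| * (1 / (|C| + 1)) ≤ 1 := by
    rw [← mul_div_assoc, mul_one, div_le_one (by positivity)]; linarith
  calc C * x ^ p * Real.log x ^ k ≤ |C| * x ^ p * Real.log x ^ k :=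
        mul_le_mul_of_nonneg_right (mul_le_mul_of_nonneg_right hC hxp) hlk
    _ ≤ |C| * x ^ p * (1 / (|C| + 1) * x ^ (q - p)) :=
        mul_le_mul_of_nonneg_left hx (mul_nonneg hC0 hxp)
    _ = (|C| * (1 / (|C| + 1))) * (x ^ p * x ^ (q - p)) := by ring
    _ ≤ 1 * (x ^ p * x ^ (q - p)) :=
        mul_le_mul_of_nonneg_right hfrac (mul_nonneg hxp (Real.rpow_nonneg hx0.le _))
    _ = x ^ q := by rw [one_mul, hsplit]

/-! ### The auxiliary function `n₀(t) = t − ξ t^ξ log² t` and local facts about `ψ` -/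

/-- `n₀(t) = t − ξ t^ξ log² t`, the smooth part of the numerator of `y'`, `y = D − x^ξ` (Robin: "la
fonction `x ↦ x − ξ x^ξ log² x` est croissante"). [cite: Robin1984Toulouse, §4 (proof of Lemme 2)] -/
def n0 (ξ t : ℝ) : ℝ := t - ξ * t ^ ξ * Real.log t ^ 2

/-- The derivative of `n₀`. [folklore] -/
private theorem hasDerivAt_n0 (ξ : ℝ) {t : ℝ} (ht : 0 < t) :
    HasDerivAt (n0 ξ) (1 - ξ * (ξ * t ^ (ξ - 1) * Real.log t ^ 2 +
      t ^ ξ * ((2 : ℕ) * Real.log t ^ (2 - 1) * t⁻¹))) t := by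
  have h1 : HasDerivAt (fun x : ℝ ↦ x ^ ξ) (ξ * t ^ (ξ - 1)) t :=
    Real.hasDerivAt_rpow_const (Or.inl ht.ne')
  have h2 : HasDerivAt (fun x : ℝ ↦ Real.log x ^ 2) ((2 : ℕ) * Real.log t ^ (2 - 1) * t⁻¹) t :=
    (Real.hasDerivAt_log ht.ne').pow 2
  have hfun : n0 ξ = fun x ↦ x - ξ * (x ^ ξ * Real.log x ^ 2) := by
    funext x; simp only [n0, mul_assoc]
  rw [hfun]
  exact (hasDerivAt_id' t).sub ((h1.mul h2).const_mul ξ)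

/-- `n₀` is eventually non-decreasing (`0 < ξ < 1`; Robin: "croissante pour `x > x₀`"). [cite: Robin1984Toulouse, §4 (proof of Lemme 2)] -/
theorem exists_monotoneOn_n0 {ξ : ℝ} (hξ0 : 0 < ξ) (hξ1 : ξ < 1) :
    ∃ X : ℝ, 2 ≤ X ∧ MonotoneOn (n0 ξ) (Ici X) := by
  have e1 := eventually_mul_rpow_mul_log_pow_le (2 * ξ ^ 2) (ξ - 1) 0 2 (by linarith)
  have e2 := eventually_mul_rpow_mul_log_pow_le (4 * ξ) (ξ - 1) 0 1 (by linarith)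
  obtain ⟨X, hX⟩ := eventually_atTop.1 (e1.and (e2.and (eventually_ge_atTop (2 : ℝ))))
  refine ⟨max X 2, le_max_right _ _, ?_⟩
  have key : ∀ t, max X 2 ≤ t → 0 ≤ 1 - ξ * (ξ * t ^ (ξ - 1) * Real.log t ^ 2 +
      t ^ ξ * ((2 : ℕ) * Real.log t ^ (2 - 1) * t⁻¹)) := by
    intro t ht
    obtain ⟨h1, h2, -⟩ := hX t ((le_max_left _ _).trans ht)
    have ht0 : 0 < t := by linarith [le_max_right X 2]
    rw [Real.rpow_zero] at h1 h2
    rw [pow_one] at h2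
    have hrew : t ^ ξ * ((2 : ℕ) * Real.log t ^ (2 - 1) * t⁻¹) = 2 * t ^ (ξ - 1) * Real.log t := by
      rw [Real.rpow_sub_one ht0.ne']
      push_cast
      field_simp
    rw [hrew]
    nlinarith [h1, h2]
  have hpos : ∀ t ∈ Ici (max X 2), 0 < t := fun t ht ↦ by
    have : (2 : ℝ) ≤ t := (le_max_right X 2).trans ht; linarith
  refine monotoneOn_of_deriv_nonneg (convex_Ici _) ?_ ?_ ?_
  · exact fun t ht ↦ (hasDerivAt_n0 ξ (hpos t ht)).continuousAt.continuousWithinAt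
  · exact fun t ht ↦ (hasDerivAt_n0 ξ (hpos t (interior_subset ht))).differentiableAt.differentiableWithinAt
  · intro t ht
    have ht' : max X 2 ≤ t := interior_subset (s := Ici (max X 2)) ht
    rw [(hasDerivAt_n0 ξ (hpos t ht')).deriv]
    exact key t ht'

/-- `ψ(m) − ψ(t) ≤ log m` for `1 ≤ t ≤ m < t + 1` (at most one prime power in `(t, m]`). [folklore] -/
private theorem psi_sub_psi_le_log {t m : ℝ} (h1 : 1 ≤ t) (htm : t ≤ m) (hmt : m < t + 1) :
    ψ m - ψ t ≤ Real.log m := by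
  have ht0 : 0 ≤ t := by linarith
  have hm1 : 1 ≤ m := h1.trans htm
  have hfl : ⌊t⌋₊ ≤ ⌊m⌋₊ := Nat.floor_le_floor htm
  have hfl' : ⌊m⌋₊ ≤ ⌊t⌋₊ + 1 := by
    have : ⌊m⌋₊ ≤ ⌊t + 1⌋₊ := Nat.floor_le_floor hmt.le
    rwa [Nat.floor_add_one ht0] at this
  have hsplit := Finset.sum_Ioc_consecutive (fun n ↦ (Λ n : ℝ)) (Nat.zero_le ⌊t⌋₊) hfl
  have hψm : ψ m = ∑ n ∈ Finset.Ioc 0 ⌊t⌋₊, Λ n + ∑ n ∈ Finset.Ioc ⌊t⌋₊ ⌊m⌋₊, Λ n := by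
    rw [Chebyshev.psi, hsplit]
  have hψt : ψ t = ∑ n ∈ Finset.Ioc 0 ⌊t⌋₊, Λ n := rfl
  rw [hψm, hψt, add_sub_cancel_left]
  have hcard : (Finset.Ioc ⌊t⌋₊ ⌊m⌋₊).card ≤ 1 := by rw [Nat.card_Ioc]; omega
  calc ∑ n ∈ Finset.Ioc ⌊t⌋₊ ⌊m⌋₊, (Λ n : ℝ) ≤ ∑ n ∈ Finset.Ioc ⌊t⌋₊ ⌊m⌋₊, Real.log m := by
        refine Finset.sum_le_sum fun n hn ↦ ?_
        have hn' := Finset.mem_Ioc.1 hn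
        have hn0 : 0 < n := by omega
        calc (Λ n : ℝ) ≤ Real.log n := ArithmeticFunction.vonMangoldt_le_log
          _ ≤ Real.log m := Real.log_le_log (by exact_mod_cast hn0)
              ((Nat.cast_le.2 hn'.2).trans (Nat.floor_le (by linarith)))
    _ = (Finset.Ioc ⌊t⌋₊ ⌊m⌋₊).card * Real.log m := by rw [Finset.sum_const, nsmul_eq_mul]
    _ ≤ 1 * Real.log m :=
        mul_le_mul_of_nonneg_right (by exact_mod_cast hcard) (Real.log_nonneg hm1)
    _ = Real.log m := one_mul _

/-- `ψ` is constant on `[m, ⌊m⌋ + 1)`. [folklore] -/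
private theorem psi_eq_psi_of_lt_floor_add_one {t m : ℝ} (hm : 0 ≤ m) (hmt : m ≤ t) (ht : t < ⌊m⌋₊ + 1) :
    ψ t = ψ m := by
  rw [psi_eq_of_mem_Ico (m := ⌊m⌋₊) ⟨(Nat.floor_le hm).trans hmt, ht⟩,
    psi_eq_of_mem_Ico (m := ⌊m⌋₊) ⟨Nat.floor_le hm, Nat.lt_floor_add_one m⟩]

/-- The signed integrand of `y = D − x^ξ`: `f(t) − ξ t^{ξ−1} = (n₀(t) − ψ(t))/(t log² t)` (Robin (15)). [cite: Robin1984Toulouse, §4 (15)] -/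
theorem dDeriv_sub_eq {ξ t : ℝ} (ht : 1 < t) :
    dDeriv t - ξ * t ^ (ξ - 1) = (n0 ξ t - ψ t) / (t * Real.log t ^ 2) := by
  have ht0 : t ≠ 0 := by linarith
  have hlog : Real.log t ≠ 0 := (Real.log_pos ht).ne'
  unfold dDeriv n0
  rw [Real.rpow_sub_one ht0]
  field_simp
  ring

/-- `∫_{x₁}^{x₂} (f(t) − ξ t^{ξ−1}) dt = (D(x₂) − x₂^ξ) − (D(x₁) − x₁^ξ)` (`2 ≤ x₁ ≤ x₂`, `ξ > 0`),
with the integrability of the integrand. [cite: Robin1984Toulouse, §4 (15)–(16)] -/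
theorem integral_dDeriv_sub_eq {ξ x₁ x₂ : ℝ} (hξ : 0 < ξ) (h1 : 2 ≤ x₁) (h12 : x₁ ≤ x₂) :
    IntervalIntegrable (fun t ↦ dDeriv t - ξ * t ^ (ξ - 1)) volume x₁ x₂ ∧
    ∫ t in x₁..x₂, (dDeriv t - ξ * t ^ (ξ - 1)) =
      (robinD x₂ - x₂ ^ ξ) - (robinD x₁ - x₁ ^ ξ) := by
  have hf := intervalIntegrable_dDeriv h1 h12
  have hgc : ContinuousOn (fun t : ℝ ↦ ξ * t ^ (ξ - 1)) (uIcc x₁ x₂) := by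
    intro t ht
    rw [uIcc_of_le h12] at ht
    have ht0 : t ≠ 0 := by linarith [ht.1]
    exact (continuousAt_const.mul (Real.continuousAt_rpow_const t (ξ - 1) (Or.inl ht0))).continuousWithinAt
  have hg : IntervalIntegrable (fun t : ℝ ↦ ξ * t ^ (ξ - 1)) volume x₁ x₂ := hgc.intervalIntegrable
  refine ⟨hf.sub hg, ?_⟩
  rw [intervalIntegral.integral_sub hf hg, integral_dDeriv_eq h1 h12, intervalIntegral.integral_const_mul,
    integral_rpow (Or.inl (by linarith : (-1 : ℝ) < ξ - 1))]
  rw [show ξ - 1 + 1 = ξ by ring]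
  field_simp
  ring

/-! ### `Ω₋`: `A(x) ≤ −x^ξ/2` for arbitrarily large `x` -/

/-- **`Ω₋` half.** If `ζ(ρ₀) = 0` with `Re ρ₀ > ξ > 1/2`, then `A(x) ≤ −x^ξ/2` for arbitrarily large
`x` (from `A ≤ D + li 2 + (Π − π)` and `D log x ≤ −x^b` frequently, `ξ < b < Re ρ₀`).
[cite: Robin1984Toulouse, §4 Lemme 2 ("l'inégalité B ≤ D donne B = Ω₋")] -/
theorem frequently_liThetaSubPi_le_neg {ρ₀ : ℂ} (h0 : riemannZeta ρ₀ = 0) {ξ : ℝ} (hξ : 1 / 2 < ξ)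
    (hξρ : ξ < ρ₀.re) :
    ∃ᶠ x in atTop, liThetaSubPi x ≤ -(1 / 2 * x ^ ξ) := by
  set b : ℝ := (ξ + ρ₀.re) / 2 with hb
  have hbξ : ξ < b := by rw [hb]; linarith
  have hbρ : b < ρ₀.re := by rw [hb]; linarith
  obtain ⟨-, hLm⟩ := frequently_le_dLog_and_dLog_le h0 (by linarith) hbρ one_pos
  have E1 := eventually_mul_rpow_mul_log_pow_le 2 ξ b 1 hbξ
  have E6 := eventually_mul_rpow_mul_log_pow_le (4 * |logIntegral 2|) 0 b 1 (by linarith)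
  have E7 := eventually_mul_rpow_mul_log_pow_le (8 / Real.log 2) (1 / 2) b 2 (by linarith)
  have Eθ := RobinOscillation.eventually_theta_ge_half
  refine (hLm.and_eventually (E1.and (E6.and (E7.and (Eθ.and (eventually_ge_atTop 4)))))).mono ?_
  rintro x ⟨hx1, e1, e6, e7, eθ, hx4⟩
  have hx0 : 0 < x := by linarith
  have hlog : 0 < Real.log x := Real.log_pos (by linarith)
  have hl2 : 0 < Real.log 2 := Real.log_pos one_lt_two
  rw [pow_one] at e1 e6
  rw [Real.rpow_zero, mul_one] at e6
  rw [← Real.sqrt_eq_rpow] at e7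
  have hθ1 : 1 < θ x := by linarith
  -- `D x ≤ -x^b / log x`
  have hD : robinD x * Real.log x ≤ -x ^ b := by
    rw [← dLog_eq_robinD_mul_log (by linarith)]; linarith
  have hA := liThetaSubPi_le (by linarith) hθ1
  -- the target, multiplied through by `log x`
  have hli : logIntegral 2 ≤ |logIntegral 2| := le_abs_self _
  have hxb : 0 < x ^ b := Real.rpow_pos_of_pos hx0 b
  have e7' : 2 * Real.sqrt x * Real.log x / Real.log 2 * Real.log x ≤ x ^ b / 4 := by
    have : 2 * Real.sqrt x * Real.log x / Real.log 2 * Real.log x =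
        (8 / Real.log 2 * Real.sqrt x * Real.log x ^ 2) / 4 := by
      field_simp; ring
    rw [this]; linarith only [e7]
  have e6' : logIntegral 2 * Real.log x ≤ x ^ b / 4 := by
    have h := mul_le_mul_of_nonneg_right hli hlog.le
    linarith only [h, e6]
  have key : (robinD x + logIntegral 2 + 2 * Real.sqrt x * Real.log x / Real.log 2) * Real.log x ≤
      -(1 / 2 * x ^ ξ) * Real.log x := by
    have expand : (robinD x + logIntegral 2 + 2 * Real.sqrt x * Real.log x / Real.log 2) * Real.log x =
        robinD x * Real.log x + logIntegral 2 * Real.log x +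
          2 * Real.sqrt x * Real.log x / Real.log 2 * Real.log x := by ring
    have e1' : -(1 / 2 * x ^ ξ) * Real.log x = -(2 * x ^ ξ * Real.log x) / 4 := by ring
    rw [expand, e1']
    linarith only [hD, e6', e7', e1, hxb]
  exact hA.trans (le_of_mul_le_mul_right key hlog)

/-! ### The local analysis at a maximum of `y = D − x^ξ` -/

/-- **At an interior maximum `m` of `y = D − x^ξ` on `[a, c]`:** `−log m ≤ n₀(m) − ψ(m) ≤ 0`, i.e.
`|ψ(m) − m + ξ m^ξ log² m| ≤ log m` up to sign (else `y` increases just right of `m`, resp. decreases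
just left of `m`). Here `n₀` is non-decreasing on `[X₁, ∞) ∋ a`. Robin: at the points of `A`
(sign changes of `y'`), "on a donc toujours `|…| ≤ ξ x_n^ξ log² x_n`". [cite: Robin1984Toulouse, §4 (proof of Lemme 2, (15)–(16))] -/
theorem n0_sub_psi_bounds_of_isMax {ξ X₁ a c m : ℝ} (hξ0 : 0 < ξ)
    (hmono : MonotoneOn (n0 ξ) (Ici X₁)) (hX₁a : X₁ ≤ a) (ha2 : 2 ≤ a) (hma : a < m) (hmc : m < c)
    (hmax : ∀ t ∈ Icc a c, robinD t - t ^ ξ ≤ robinD m - m ^ ξ) :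
    -Real.log m ≤ n0 ξ m - ψ m ∧ n0 ξ m - ψ m ≤ 0 := by
  have hm0 : 0 < m := by linarith
  have hmX₁ : X₁ ≤ m := by linarith
  constructor
  · -- (M2) else `y` decreases just to the left of `m`
    by_contra hN
    push Not at hN
    set t₀ : ℝ := max a (m - 1 / 2) with ht₀
    have ht₀m : t₀ < m := max_lt hma (by linarith)
    have hat₀ : a ≤ t₀ := le_max_left _ _
    have ht₀1 : m - 1 / 2 ≤ t₀ := le_max_right _ _
    obtain ⟨hgi, hint⟩ := integral_dDeriv_sub_eq (ξ := ξ) hξ0 (by linarith : (2 : ℝ) ≤ t₀) ht₀m.le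
    have hneg' : ∀ t ∈ Ioo t₀ m, 0 < -(dDeriv t - ξ * t ^ (ξ - 1)) := by
      intro t ht
      have ht1 : 1 < t := by linarith [ht.1]
      have hψ : ψ m - ψ t ≤ Real.log m := psi_sub_psi_le_log ht1.le ht.2.le (by linarith [ht.1])
      have hn : n0 ξ t ≤ n0 ξ m := hmono (show X₁ ≤ t by linarith [ht.1]) hmX₁ ht.2.le
      rw [dDeriv_sub_eq ht1, ← neg_div]
      exact div_pos (by linarith) (by have := Real.log_pos ht1; positivity)
    have hI : 0 < ∫ t in t₀..m, -(dDeriv t - ξ * t ^ (ξ - 1)) :=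
      intervalIntegral.intervalIntegral_pos_of_pos_on hgi.neg hneg' ht₀m
    rw [intervalIntegral.integral_neg, hint] at hI
    have := hmax t₀ ⟨hat₀, by linarith⟩
    linarith
  · -- (M1) else `y` increases just to the right of `m`
    by_contra hN
    push Not at hN
    set m' : ℝ := min c (⌊m⌋₊ + 1) with hm'
    have hmm' : m < m' := lt_min hmc (Nat.lt_floor_add_one m)
    have hm'c : m' ≤ c := min_le_left _ _
    obtain ⟨hgi, hint⟩ := integral_dDeriv_sub_eq (ξ := ξ) hξ0 (by linarith : (2 : ℝ) ≤ m) hmm'.le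
    have hpos : ∀ t ∈ Ioo m m', 0 < dDeriv t - ξ * t ^ (ξ - 1) := by
      intro t ht
      have ht1 : 1 < t := by linarith [ht.1]
      have hψ : ψ t = ψ m :=
        psi_eq_psi_of_lt_floor_add_one hm0.le ht.1.le (ht.2.trans_le (min_le_right _ _))
      have hn : n0 ξ m ≤ n0 ξ t := hmono hmX₁ (show X₁ ≤ t by linarith [ht.1]) ht.1.le
      rw [dDeriv_sub_eq ht1, hψ]
      exact div_pos (by linarith) (by have := Real.log_pos ht1; positivity)
    have hI : 0 < ∫ t in m..m', (dDeriv t - ξ * t ^ (ξ - 1)) :=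
      intervalIntegral.intervalIntegral_pos_of_pos_on hgi hpos hmm'
    rw [hint] at hI
    have := hmax m' ⟨by linarith, hm'c⟩
    linarith

/-- **The final estimate at such a point.** If `m > 4`, `θ(m) ≥ m/2`,
`|ψ(m) − m| ≤ ξ m^ξ log² m + log m`, `D(m) > m^ξ`, and the four eventual inequalities hold at `m`,
then `A(m) ≥ m^ξ/2` (Robin: "`B(x_n) = D(x_n) + O(x_n^{2ξ−1} log² x_n)` … ce qui montre que `B = Ω₊(x^ξ)`").
[cite: Robin1984Toulouse, §4 (end of proof of Lemme 2)] -/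
theorem half_rpow_le_liThetaSubPi {ξ m : ℝ} (hm4 : 4 < m) (hθ : m / 2 ≤ θ m)
    (hψabs : |ψ m - m| ≤ ξ * m ^ ξ * Real.log m ^ 2 + Real.log m) (hDm : m ^ ξ < robinD m)
    (e2 : 16 * Real.sqrt m ≤ m ^ ξ) (e3 : 192 * ξ ^ 2 * m ^ (2 * ξ - 1) * Real.log m ^ 2 ≤ m ^ ξ)
    (e4 : 192 * m⁻¹ ≤ m ^ ξ) (e5 : 8 * (96 + |logIntegral 2|) ≤ m ^ ξ) :
    1 / 2 * m ^ ξ ≤ liThetaSubPi m := by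
  have hm0 : 0 < m := by linarith
  have hlogm : 0 < Real.log m := Real.log_pos (by linarith)
  set e : ℝ := Real.log m * (ξ * m ^ ξ * Real.log m + 1 + 2 * Real.sqrt m) with he
  have hθabs : |θ m - m| ≤ e := by
    have h1 : |ψ m - θ m| ≤ 2 * Real.sqrt m * Real.log m :=
      Chebyshev.abs_psi_sub_theta_le_sqrt_mul_log (by linarith)
    calc |θ m - m| = |(ψ m - m) - (ψ m - θ m)| := by ring_nf
      _ ≤ |ψ m - m| + |ψ m - θ m| := abs_sub _ _
      _ ≤ (ξ * m ^ ξ * Real.log m ^ 2 + Real.log m) + 2 * Real.sqrt m * Real.log m := add_le_add hψabs h1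
      _ = e := by rw [he]; ring
  -- the lower bound for `A(m)`
  have hlow := le_liThetaSubPi (x := m) (u := m / 2) (by linarith) (by linarith) (by linarith) hθ
  -- the gap term: `(θ m − m)²/((m/2) log²(m/2)) ≤ 8 e²/(m log² m) ≤ 24ξ² m^{2ξ−1}log²m + 24/m + 96`
  have hl2 : Real.log (m / 2) ≥ Real.log m / 2 := by
    have : Real.log 2 ≤ Real.log m / 2 := by
      have h4 : Real.log 4 = 2 * Real.log 2 := by
        rw [show (4 : ℝ) = 2 ^ 2 by norm_num, Real.log_pow]; norm_num
      have := Real.log_le_log (by norm_num) hm4.le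
      linarith
    rw [Real.log_div hm0.ne' two_ne_zero]
    linarith
  have hden : m * Real.log m ^ 2 / 8 ≤ m / 2 * Real.log (m / 2) ^ 2 := by
    have hl2' : 0 ≤ Real.log m / 2 := by linarith
    have h := pow_le_pow_left₀ hl2' hl2 2
    have : m * Real.log m ^ 2 / 8 = m / 2 * (Real.log m / 2) ^ 2 := by ring
    rw [this]
    exact mul_le_mul_of_nonneg_left h (by linarith)
  have hden0 : 0 < m * Real.log m ^ 2 / 8 := by positivity
  have hgap : (θ m - m) ^ 2 / (m / 2 * Real.log (m / 2) ^ 2) ≤ 8 * e ^ 2 / (m * Real.log m ^ 2) := by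
    have hsq : (θ m - m) ^ 2 ≤ e ^ 2 := by
      rw [← sq_abs]; exact pow_le_pow_left₀ (abs_nonneg _) hθabs 2
    calc (θ m - m) ^ 2 / (m / 2 * Real.log (m / 2) ^ 2)
        ≤ (θ m - m) ^ 2 / (m * Real.log m ^ 2 / 8) := div_le_div_of_nonneg_left (sq_nonneg _) hden0 hden
      _ ≤ e ^ 2 / (m * Real.log m ^ 2 / 8) := div_le_div_of_nonneg_right hsq hden0.le
      _ = 8 * e ^ 2 / (m * Real.log m ^ 2) := by field_simp
  have hgap2 : 8 * e ^ 2 / (m * Real.log m ^ 2) ≤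
      24 * ξ ^ 2 * m ^ (2 * ξ - 1) * Real.log m ^ 2 + 24 / m + 96 := by
    have hsq3 : (ξ * m ^ ξ * Real.log m + 1 + 2 * Real.sqrt m) ^ 2 ≤
        3 * ((ξ * m ^ ξ * Real.log m) ^ 2 + 1 + (2 * Real.sqrt m) ^ 2) := by
      nlinarith [sq_nonneg (ξ * m ^ ξ * Real.log m - 1), sq_nonneg (ξ * m ^ ξ * Real.log m - 2 * Real.sqrt m),
        sq_nonneg (1 - 2 * Real.sqrt m)]
    have hγ2 : (2 * Real.sqrt m) ^ 2 = 4 * m := by rw [mul_pow, Real.sq_sqrt hm0.le]; ring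
    have h2ξ : m ^ (2 * ξ - 1) = (m ^ ξ) ^ 2 / m := by
      rw [Real.rpow_sub_one hm0.ne', ← Real.rpow_natCast (m ^ ξ) 2, ← Real.rpow_mul hm0.le]
      congr 2; push_cast; ring
    have e8 : 8 * e ^ 2 / (m * Real.log m ^ 2) = 8 * (ξ * m ^ ξ * Real.log m + 1 + 2 * Real.sqrt m) ^ 2 / m := by
      rw [he]; field_simp
    calc 8 * e ^ 2 / (m * Real.log m ^ 2) = 8 * (ξ * m ^ ξ * Real.log m + 1 + 2 * Real.sqrt m) ^ 2 / m := e8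
      _ ≤ 24 * ((ξ * m ^ ξ * Real.log m) ^ 2 + 1 + (2 * Real.sqrt m) ^ 2) / m :=
          div_le_div_of_nonneg_right (by linarith only [hsq3]) hm0.le
      _ = 24 * ξ ^ 2 * m ^ (2 * ξ - 1) * Real.log m ^ 2 + 24 / m + 96 := by
          rw [hγ2, h2ξ]; field_simp; ring
  have e4' : 24 / m ≤ m ^ ξ / 8 := by
    have : 24 / m = 192 * m⁻¹ / 8 := by field_simp; ring
    rw [this]; linarith only [e4]
  have hli : -|logIntegral 2| ≤ logIntegral 2 := neg_abs_le _
  linarith only [hlow, hDm, hgap, hgap2, e2, e3, e4', e5, hli]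

/-! ### `Ω₊`: `A(x) ≥ x^ξ/2` for arbitrarily large `x` (Robin's critical-point argument) -/

/-- **`Ω₊` half** (Robin 1984, proof of Lemma 2, the case "qui demande plus d'efforts"). If
`ζ(ρ₀) = 0` with `Re ρ₀ > ξ > 1/2`, then `A(x) ≥ x^ξ/2` for arbitrarily large `x`. With
`y = D − x^ξ` (continuous, `y' = (x − ψ(x) − ξ x^ξ log²x)/(x log²x)` off the prime powers):
between a point where `y < 0`, a later point where `y > 0` (both from Lemma 1) and a still later
point where `y < 0`, `y` attains an interior maximum `m`; there `|ψ(m) − m| ≤ ξ m^ξ log² m + log m`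
(else `y` would increase to the right of `m` or to the left of `m`), so the concavity gap
`(θ−x)/log x − (li θ − li x) = O((ψ(m) − m)²/(m log² m))` is `o(m^ξ)` and
`A(m) = D(m) + li 2 − (ψ−θ)/log − gap + (Π − π) ≥ m^ξ/2`.
[cite: Robin1984Toulouse, §4 Lemme 2 ("La démonstration de B = Ω₊(x^ξ) demande plus d'efforts")] -/
theorem frequently_le_liThetaSubPi {ρ₀ : ℂ} (h0 : riemannZeta ρ₀ = 0) {ξ : ℝ} (hξ : 1 / 2 < ξ)
    (hξρ : ξ < ρ₀.re) :
    ∃ᶠ x in atTop, 1 / 2 * x ^ ξ ≤ liThetaSubPi x := by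
  have hρ1 : ρ₀.re < 1 := by
    by_contra h
    exact riemannZeta_ne_zero_of_one_le_re (not_lt.1 h) h0
  have hξ1 : ξ < 1 := hξρ.trans hρ1
  have hξ0 : 0 < ξ := by linarith
  set b : ℝ := (ξ + ρ₀.re) / 2 with hb
  have hbξ : ξ < b := by rw [hb]; linarith
  have hbρ : b < ρ₀.re := by rw [hb]; linarith
  obtain ⟨hLp, hLm⟩ := frequently_le_dLog_and_dLog_le h0 (by linarith) hbρ one_pos
  obtain ⟨X₁, hX₁2, hmono⟩ := exists_monotoneOn_n0 hξ0 hξ1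
  have E1 := eventually_mul_rpow_mul_log_pow_le 2 ξ b 1 hbξ
  have E2 := eventually_mul_rpow_mul_log_pow_le 16 (1 / 2) ξ 0 hξ
  have E3 := eventually_mul_rpow_mul_log_pow_le (192 * ξ ^ 2) (2 * ξ - 1) ξ 2 (by linarith)
  have E4 := eventually_mul_rpow_mul_log_pow_le 192 (-1) ξ 0 (by linarith)
  have E5 := eventually_mul_rpow_mul_log_pow_le (8 * (96 + |logIntegral 2|)) 0 ξ 0 hξ0
  have Eθ := RobinOscillation.eventually_theta_ge_half
  by_contra H
  have Hev : ∀ᶠ x in atTop, liThetaSubPi x < 1 / 2 * x ^ ξ := by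
    simpa only [not_le] using not_frequently.1 H
  obtain ⟨X, hX⟩ := eventually_atTop.1
    (Hev.and (E1.and (E2.and (E3.and (E4.and (E5.and (Eθ.and (eventually_ge_atTop (max X₁ 4)))))))))
  -- three points `a < xs < c` with `y a < 0 < y xs`, `y c < 0`
  obtain ⟨a, ha1, haX⟩ := (hLm.and_eventually (eventually_ge_atTop X)).exists
  obtain ⟨xs, hxs1, hxsa⟩ := (hLp.and_eventually (eventually_ge_atTop (a + 1))).exists
  obtain ⟨c, hc1, hcx⟩ := (hLm.and_eventually (eventually_ge_atTop (xs + 1))).exists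
  have hPa := hX a haX
  have ha4 : 4 ≤ a := (le_max_right X₁ 4).trans hPa.2.2.2.2.2.2.2
  have haX₁ : X₁ ≤ a := (le_max_left X₁ 4).trans hPa.2.2.2.2.2.2.2
  set y : ℝ → ℝ := fun t ↦ robinD t - t ^ ξ with hy
  have hneg : ∀ t, 1 < t → dLog t ≤ -(1 * t ^ b) → y t < 0 := by
    intro t ht hd
    have hlog : 0 < Real.log t := Real.log_pos ht
    have htb : 0 < t ^ b := Real.rpow_pos_of_pos (by linarith) b
    have hD : robinD t * Real.log t < 0 := by rw [← dLog_eq_robinD_mul_log ht]; linarith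
    have hD' : robinD t < 0 := by
      by_contra h; exact absurd (mul_nonneg (not_lt.1 h) hlog.le) (not_le.2 hD)
    have : 0 < t ^ ξ := Real.rpow_pos_of_pos (by linarith) ξ
    simp only [hy]; linarith
  have hya : y a < 0 := hneg a (by linarith) ha1
  have hyc : y c < 0 := hneg c (by linarith) hc1
  have hyxs : 0 < y xs := by
    obtain ⟨-, e1, -⟩ := hX xs (by linarith)
    have hlog : 0 < Real.log xs := Real.log_pos (by linarith)
    have hxξ : 0 < xs ^ ξ := Real.rpow_pos_of_pos (by linarith) ξ
    rw [pow_one] at e1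
    have hD : xs ^ b ≤ robinD xs * Real.log xs := by
      rw [← dLog_eq_robinD_mul_log (by linarith)]; linarith
    have h2 : xs ^ ξ * Real.log xs < robinD xs * Real.log xs := by nlinarith
    have h3 : xs ^ ξ < robinD xs := lt_of_mul_lt_mul_right h2 hlog.le
    simp only [hy]; linarith
  -- the maximum of `y` on `[a, c]`
  have hac : a ≤ c := by linarith
  have hcont : ContinuousOn y (Icc a c) := by
    refine ContinuousOn.sub (continuousOn_robinD.mono fun t ht ↦ ?_) fun t ht ↦ ?_
    · exact (show (2 : ℝ) ≤ t by linarith [ht.1])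
    · exact (Real.continuousAt_rpow_const t ξ (Or.inr hξ0.le)).continuousWithinAt
  obtain ⟨m, hmI, hmax⟩ := isCompact_Icc.exists_isMaxOn (nonempty_Icc.2 hac) hcont
  have hmax' : ∀ t ∈ Icc a c, y t ≤ y m := fun t ht ↦ hmax ht
  have hym : 0 < y m := hyxs.trans_le (hmax' xs ⟨by linarith, by linarith⟩)
  have hma : a < m := by
    rcases hmI.1.lt_or_eq with h | h
    · exact h
    · exfalso; rw [← h] at hym; linarith
  have hmc : m < c := by
    rcases hmI.2.lt_or_eq with h | h
    · exact h
    · exfalso; rw [h] at hym; linarith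
  have hm4 : 4 < m := by linarith
  have hm0 : 0 < m := by linarith
  have hmX₁ : X₁ ≤ m := by linarith
  obtain ⟨hAm, -, e2, e3, e4, e5, eθ, -⟩ := hX m (by linarith)
  -- the local analysis at `m` and the final estimate
  obtain ⟨hNlog, hN0⟩ := n0_sub_psi_bounds_of_isMax hξ0 hmono haX₁ (by linarith) hma hmc
    (fun t ht ↦ by simpa only [hy] using hmax' t ht)
  have hlogm : 0 < Real.log m := Real.log_pos (by linarith)
  have hP : 0 ≤ ξ * m ^ ξ * Real.log m ^ 2 := by positivity
  have hψabs : |ψ m - m| ≤ ξ * m ^ ξ * Real.log m ^ 2 + Real.log m := by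
    simp only [n0] at hN0 hNlog
    rw [abs_le]
    constructor
    · linarith only [hN0, hP, hlogm]
    · linarith only [hNlog, hP]
  have hDm : m ^ ξ < robinD m := by simp only [hy] at hym; linarith
  rw [pow_zero, mul_one, ← Real.sqrt_eq_rpow] at e2
  rw [Real.rpow_zero, mul_one, pow_zero, mul_one] at e5
  rw [pow_zero, mul_one, Real.rpow_neg_one] at e4
  have := half_rpow_le_liThetaSubPi hm4 eθ hψabs hDm e2 e3 e4 e5
  linarith only [this, hAm]

end Structure

end RobinLiTheta

/-! ### The named fact `Robin1984Toulouse_lemma2` DISCHARGED, and the unconditional consequences -/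

open RobinLiTheta in
/-- **DISCHARGE of the named fact `Robin1984Toulouse_lemma2`** (Robin 1984 (Toulouse), Lemma 2 with
(8), `k = 1`, as quoted in Nicolas 2017, proof of Cor. 1.1: "if the Riemann Hypothesis does not hold,
there exists `b > 1/2` such that `A(x) = Ω±(x^b)`"): from `¬RH` a zero `ρ₀` of `ζ` with
`1/2 < Re ρ₀ < 1` (`ξ(1−s) = ξ(s)`), then `b = (1/2 + Re ρ₀)/2`, `c = 1/2` by
`RobinLiTheta.frequently_le_liThetaSubPi` / `frequently_liThetaSubPi_le_neg`. RH-FREE; nothing here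
bears on the truth of RH. [cite: Robin1984Toulouse, §4 Lemme 2 and (8); Nicolas2017, proof of Cor. 1.1] -/
theorem Robin1984Toulouse_lemma2_holds : Robin1984Toulouse_lemma2 := by
  intro hRH
  obtain ⟨s₀, hs₀, hre, -, -⟩ := Nicolas.exists_zero_right_of_not_RH hRH
  obtain ⟨-, hζ⟩ := Nicolas.zetaOne_eq_zero_iff.1 hs₀
  have hρre : 1 / 2 < (1 + s₀).re := by simp; linarith
  set ξ : ℝ := (1 / 2 + (1 + s₀).re) / 2 with hξ
  have hξ1 : 1 / 2 < ξ := by rw [hξ]; linarith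
  have hξ2 : ξ < (1 + s₀).re := by rw [hξ]; linarith
  exact ⟨ξ, hξ1, 1 / 2, by norm_num, frequently_le_liThetaSubPi hζ hξ1 hξ2,
    frequently_liThetaSubPi_le_neg hζ hξ1 hξ2⟩

/-- **Robin 1984, Thm. 1, `⟸` half, now unconditional**: if `A(x) = li(θ(x)) − π(x) > 0` for all large
`x`, then the Riemann hypothesis holds ("`A(x) > 0` pour `x` assez grand" `⟹` RH). RH-FREE
(an implication; nothing is asserted about RH). [cite: Robin1984Toulouse, Thm. 1; Nicolas2017, Cor. 1.1] -/
theorem riemannHypothesis_of_eventually_liThetaSubPi_pos (h : ∀ᶠ x : ℝ in atTop, 0 < liThetaSubPi x) :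
    RiemannHypothesis := by
  by_contra hRH
  obtain ⟨b, -, c, hc, -, hneg⟩ := Robin1984Toulouse_lemma2_holds hRH
  obtain ⟨x, hx, hpos, hx0⟩ := (hneg.and_eventually (h.and (eventually_gt_atTop 0))).exists
  have : 0 < c * x ^ b := mul_pos hc (Real.rpow_pos_of_pos hx0 b)
  linarith

/-- **Nicolas 2017, Cor. 1.1 for (1.8)** with the Robin half discharged: `Nicolas2017_thm1_1` alone now
gives `RH ⟺ A(x) > 0` for every `x ≥ 11`. RH-EQUIVALENT (proved as an equivalence from the remaining
named fact; neither side asserted). [cite: Nicolas2017, Cor. 1.1 (1.8)] -/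
theorem riemannHypothesis_iff_liThetaSubPi_pos_of' (h1 : Nicolas2017_thm1_1) :
    RiemannHypothesis ↔ ∀ x : ℝ, 11 ≤ x → 0 < liThetaSubPi x :=
  riemannHypothesis_iff_liThetaSubPi_pos_of h1 Robin1984Toulouse_lemma2_holds

/-- **Robin 1984, Thm. 1 / Nicolas 2017, Cor. 1.1 (asymptotic form)** with the Robin half discharged:
`Nicolas2017_thm1_1` alone gives `RH ⟺ A(x) > 0` for all large `x`. RH-EQUIVALENT (from the remaining
named fact). [cite: Robin1984Toulouse, Thm. 1; Nicolas2017, Cor. 1.1] -/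
theorem riemannHypothesis_iff_eventually_liThetaSubPi_pos_of' (h1 : Nicolas2017_thm1_1) :
    RiemannHypothesis ↔ ∀ᶠ x : ℝ in atTop, 0 < liThetaSubPi x :=
  riemannHypothesis_iff_eventually_liThetaSubPi_pos_of h1 Robin1984Toulouse_lemma2_holds

end Literature.NumberTheory.LFunctions

end
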